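import Literature.NumberTheory.EllipticCurves.EichlerShimuraPeriods
import Literature.NumberTheory.EllipticCurves.ModularCurveSturmProofs
import Mathlib.Analysis.Calculus.DerivativeTest
import Mathlib.LinearAlgebra.Vandermonde
import Mathlib.LinearAlgebra.Matrix.Determinant.Basic
import HarnessLib

/-!
# Real injectivity of the Eichler–Shimura map on `S_k(Γ₀(N))` in every even weight
# (the injectivity half of Shimura's Thm. 8.4 over `ℝ`), by a maximum principle

For `f ∈ S_{n+2}(Γ₀(N))` let `c_f(γ)(u, v)` (`periodFn`, `EichlerShimuraPeriods`) be its period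
cocycle and `periodLatticeK n ⊆ S_{n+2}(Γ₀(N))^∨` the lattice of period functionals
`f ↦ c_f(γ)(q)`, `γ ∈ Γ₀(N)`, `q ∈ ℤ²` (finitely generated, `T_p^∨`-stable, separating over `ℂ`).
Shimura's "discrete submodule of maximal rank" (3.5.20) needs the *real* statement: the real
Eichler–Shimura map `f ↦ (re φ(f))_φ` is injective, i.e. `ℝ · periodLatticeK = S^∨`. This file
proves it for **every level `N` and every even `n`** (weights `k = 2, 4, 6, …`), in the stronger
cohomological form:

* `eq_zero_of_isReCoboundary`: if `re c_f(γ)(p) = P(γp) - P(p)` for all `γ ∈ Γ₀(N)`, `p ∈ ℝ²`,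
  for one real homogeneous polynomial `P = momPoly x₀` of degree `n` — i.e. the class of `re c_f`
  in `H¹(Γ₀(N), Symⁿ(ℝ²))` vanishes — then `f = 0`;
* `eq_zero_of_re_periodFn_int_coboundary` (the same with integer points `q ∈ ℤ²`),
  `eq_zero_of_forall_re_periodLatticeK_eq_zero` (`re φ(f) = 0` for all `φ ∈ periodLatticeK n`
  forces `f = 0`), and **`periodLatticeK_span_real_eq_top`**: `ℝ · periodLatticeK n = S^∨`.

Classically (Shimura 1971, §8.2, (8.2.17)–(8.2.19) and Thm. 8.4) this is proved with the
Petersson scalar product through Stokes' theorem on a triangulated fundamental domain (or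
Haberland's formula); the tree's `EichlerShimuraPeriodsGamma1RealSpanProofs` proves the plain
(non-cohomological) statement for `Γ₁(N)` and `k ≥ 7` with twisted `L`-values. **The proof here
is different and elementary-analytic** (no integration over a fundamental domain, no Hecke theory,
all weights including `k = 4, 6`):

1. (§1–§2, algebra of `Symⁿ` in *moment coordinates*.) `momPoly n x (u, v) = ∑ C(n,j) xⱼ vʲ(-u)ⁿ⁻ʲ`
   is the shape of the kernel `∫ φ(z)(zv - u)ⁿ dz` (`eichlerKernel_eq_momPoly`); `e(z) = (zʲ)ⱼ` has
   `momPoly (e z) (u, v) = (zv - u)ⁿ`; the form `B(x, y) = ∑ (-1)ʲ C(n,j) xⱼ y_{n-j}` (`invForm`) is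
   symmetric for even `n`, reproducing (`B(x, e w) = momPoly x (w, 1)`), `B(e z, e w) = (z - w)ⁿ`,
   nondegenerate (pure powers at `n + 1` nodes are a basis, Vandermonde), and **`SL₂`-invariant in
   relational form** (`invForm_eq_of_momPoly_mulVec`: `momPoly x ∘ M = momPoly y ⇒ B(y,y) = B(x,x)`,
   from `e(z) ∘ M = (a - cz)ⁿ e(M⁻¹z)` and `(a - cz)(a - cw)(M⁻¹z - M⁻¹w) = z - w`).
2. (§4) With `a(τ) = (∫_τ^{i∞} f zʲ dz)ⱼ` and `r = re a + x₀`, the transformation law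
   `K(γτ, γp) = K(τ, p) - c(γ)(p)` (`periodFn_eq_of_mem`) and the hypothesis give
   `momPoly r(γτ) ∘ γ = momPoly r(τ)`, so **`Q = (-1)^{n/2} B(r, r)` is `Γ₀(N)`-invariant**.
3. (§5–§6) Along the lines `w₀ + t`, `w₀ + it` the second derivatives of `Q(g • w)` add up to
   `2(-1)^{n/2} re B_ℂ(G', conj G')` (the `G''`-terms cancel by holomorphy), and for
   `G' = -f(gw)(cw + d)⁻² e(gw)`, `B(e ζ, e ζ̄) = (ζ - ζ̄)ⁿ = (2i im ζ)ⁿ`: **`"ΔQ" =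
   2|f(gw)|²|cw + d|⁻⁴(2 im gw)ⁿ ≥ 0`**. So at a local maximum of `Q + (quadratic)` the
   one-variable second-derivative test (Mathlib `isLocalMin_of_deriv_deriv_pos`) gives
   `2|f|²(…)ⁿ + 2A + 2B ≤ 0` (`laplace_qSlash`).
4. (§7) At each cusp `g∞`, `Q(g • w)` has a limit as `im w → ∞`, `|re w| ≤ N` (transformation law
   with `f ∣ g`, decay of its moments `exists_norm_powPrimitive_le`, and reconstruction of a vector
   from its evaluations `momPoly (·)(l, 1)`, `l = 0..n`); it is `N`-periodic (`g Tᴺ g⁻¹ ∈ Γ₀(N)`);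
   and every value of `Q` is a value of some `Q(g_i • w)`, `im w > 1/2`, `g_i` over
   `SL(2, ℤ)/Γ₀(N)` (Mathlib `ModularGroup.exists_smul_mem_fd`). Hence `Q` is bounded; let
   `S = sup Q`.
5. (§9) If `S = Q(τ₀)` is attained: maximising `Q + ε|w - τ₀|²` on small discs shows `f` vanishes
   somewhere on every small circle about `τ₀`, so `f ≡ 0` (identity theorem). If not, some cusp
   limit equals `S`, and comparing `Q(g • w)` on strips `1 ≤ im w ≤ Y₂` with the affine function of
   `im w` interpolating `max_{im w = 1} Q(g • ·) < S` and `S`, plus `ε(im w - 1)(im w - Y₂)`,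
   gives `Q(g • w) ≤ max_{im = 1} < S` high in the cusp — a contradiction.

Everything is proved; there are no named facts. Auxiliary definitions: `momPoly`, `powVec`,
`invForm`, `reVec`, `imVec`, `rmat`, `momVec`, `rmomVec`, `IsReCoboundary`, `qInv`, `momVecSlash`,
`momVecSlash'`, `dFactor`, `qSlash`, `cuspFilter`, `evalMap`.

## References

* G. Shimura, *Introduction to the arithmetic theory of automorphic functions*, Publ. Math. Soc.
  Japan 11, Iwanami Shoten / Princeton UP (1971): §8.2 ((8.2.12)–(8.2.20)), Thm. 8.4 (p. 234),
  (3.5.20) (p. 84), §8.4 (p. 241).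
* F. Diamond, J. Shurman, *A first course in modular forms*, GTM 228, Springer (2005), §6.5.
-/

noncomputable section

open scoped MatrixGroups ModularForm Topology Manifold ComplexConjugate

open CongruenceSubgroup Complex MeasureTheory Set Filter Function
open UpperHalfPlane hiding I

namespace Literature.NumberTheory.EllipticCurves.ModularForms

/-! ### §1. The moment model of `Symⁿ`: `momPoly`, `powVec`, the invariant form `invForm` -/

section MomentAlgebra

variable {K : Type*} [CommRing K] (n : ℕ)

/-- The **moment polynomial** of a coefficient vector `x ∈ Kⁿ⁺¹`:
`momPoly n x (u, v) = ∑ⱼ C(n,j) xⱼ vʲ (-u)ⁿ⁻ʲ` — the shape of the Eichler–Shimura kernel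
`∫ φ(z)(zv - u)ⁿ dz = ∑ⱼ C(n,j) (∫ φ zʲ) vʲ(-u)ⁿ⁻ʲ` (`eichlerKernel`), linear in `x`. [folklore] -/
def momPoly : (Fin (n + 1) → K) →ₗ[K] ((Fin 2 → K) → K) where
  toFun x p := ∑ j : Fin (n + 1), (n.choose j : K) * x j * p 1 ^ (j : ℕ) * (-(p 0)) ^ (n - j)
  map_add' x y := by
    funext p
    simp only [Pi.add_apply, ← Finset.sum_add_distrib]
    refine Finset.sum_congr rfl fun j _ ↦ ?_
    ring
  map_smul' c x := by
    funext p
    simp only [Pi.smul_apply, smul_eq_mul, RingHom.id_apply, Finset.mul_sum]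
    refine Finset.sum_congr rfl fun j _ ↦ ?_
    ring

/-- Unfolding `momPoly`. [folklore] -/
theorem momPoly_apply (x : Fin (n + 1) → K) (p : Fin 2 → K) :
    momPoly n x p =
      ∑ j : Fin (n + 1), (n.choose j : K) * x j * p 1 ^ (j : ℕ) * (-(p 0)) ^ (n - j) := rfl

/-- The **pure power vector** `e(z) = (zʲ)ⱼ` (the moments of a point mass at `z`). [folklore] -/
def powVec (z : K) : Fin (n + 1) → K := fun j ↦ z ^ (j : ℕ)

/-- Unfolding `powVec`. [folklore] -/
@[simp] theorem powVec_apply (z : K) (j : Fin (n + 1)) : powVec n z j = z ^ (j : ℕ) := rfl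

/-- The **invariant bilinear form** on `Symⁿ` in moment coordinates:
`invForm n x y = ∑ⱼ (-1)ʲ C(n,j) xⱼ y_{n-j}` (symmetric for even `n`). [folklore] -/
def invForm : (Fin (n + 1) → K) →ₗ[K] (Fin (n + 1) → K) →ₗ[K] K :=
  LinearMap.mk₂ K
    (fun x y ↦ ∑ j : Fin (n + 1), (-1) ^ (j : ℕ) * (n.choose j : K) * x j * y (Fin.rev j))
    (fun x x' y ↦ by
      simp only [Pi.add_apply, ← Finset.sum_add_distrib]
      refine Finset.sum_congr rfl fun j _ ↦ ?_
      ring)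
    (fun c x y ↦ by
      simp only [Pi.smul_apply, smul_eq_mul, Finset.mul_sum]
      refine Finset.sum_congr rfl fun j _ ↦ ?_
      ring)
    (fun x y y' ↦ by
      simp only [Pi.add_apply, ← Finset.sum_add_distrib]
      refine Finset.sum_congr rfl fun j _ ↦ ?_
      ring)
    (fun c x y ↦ by
      simp only [Pi.smul_apply, smul_eq_mul, Finset.mul_sum]
      refine Finset.sum_congr rfl fun j _ ↦ ?_
      ring)

/-- Unfolding `invForm`. [folklore] -/
theorem invForm_apply (x y : Fin (n + 1) → K) :
    invForm n x y = ∑ j : Fin (n + 1), (-1) ^ (j : ℕ) * (n.choose j : K) * x j * y (Fin.rev j) :=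
  rfl

variable {n}

/-- `(rev j : ℕ) = n - j` in `Fin (n + 1)`. [folklore] -/
theorem val_rev_eq (j : Fin (n + 1)) : ((Fin.rev j : Fin (n + 1)) : ℕ) = n - j := by
  rw [Fin.val_rev]
  omega

/-- `(j : ℕ) ≤ n` for `j : Fin (n + 1)`. [folklore] -/
theorem fin_le (j : Fin (n + 1)) : (j : ℕ) ≤ n := Nat.lt_succ_iff.mp j.isLt

/-- For even `n` and `j ≤ n`, `(-1)ⁿ⁻ʲ = (-1)ʲ`. [folklore] -/
theorem neg_one_pow_sub_of_even (hn : Even n) {j : ℕ} (hj : j ≤ n) :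
    (-1 : K) ^ (n - j) = (-1) ^ j := by
  have h1 : (-1 : K) ^ (n - j) * (-1) ^ j = 1 := by
    rw [← pow_add, Nat.sub_add_cancel hj, hn.neg_one_pow]
  have h2 : (-1 : K) ^ j * (-1) ^ j = 1 := by
    rw [← pow_add, ← two_mul, pow_mul]
    simp
  calc (-1 : K) ^ (n - j) = (-1) ^ (n - j) * ((-1) ^ j * (-1) ^ j) := by rw [h2, mul_one]
    _ = (-1) ^ j := by rw [← mul_assoc, h1, one_mul]

/-- Homogeneity of the moment polynomial in the point: `momPoly x (t p) = tⁿ momPoly x p`. [folklore] -/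
theorem momPoly_smul_right (x : Fin (n + 1) → K) (t : K) (p : Fin 2 → K) :
    momPoly n x (t • p) = t ^ n * momPoly n x p := by
  simp only [momPoly_apply, Pi.smul_apply, smul_eq_mul, Finset.mul_sum]
  refine Finset.sum_congr rfl fun j _ ↦ ?_
  have hj := fin_le j
  have : t ^ n = t ^ (j : ℕ) * t ^ (n - j) := by
    rw [← pow_add, Nat.add_sub_cancel' hj]
  rw [this, show -(t * p 0) = t * (-(p 0)) by ring, mul_pow, mul_pow]
  ring

/-- **`momPoly (e z) (u, v) = (zv - u)ⁿ`** (binomial theorem). [folklore] -/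
theorem momPoly_powVec (z : K) (p : Fin 2 → K) :
    momPoly n (powVec n z) p = (z * p 1 - p 0) ^ n := by
  rw [momPoly_apply, sub_eq_add_neg, add_pow, Finset.sum_range]
  refine Finset.sum_congr rfl fun j _ ↦ ?_
  rw [powVec_apply, mul_pow]
  ring

/-- **Covariance of the pure powers**: if `(a - cz) z' = dz - b` then
`momPoly (e z) (M p) = (a - cz)ⁿ momPoly (e z') p` for `M = (a b; c d)`
(i.e. `e(z) ∘ M = (a - cz)ⁿ e(M⁻¹z)` when `det M = 1`). [folklore] -/
theorem momPoly_powVec_mulVec (M : Matrix (Fin 2) (Fin 2) K) {z z' : K}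
    (hz : (M 0 0 - M 1 0 * z) * z' = M 1 1 * z - M 0 1) (p : Fin 2 → K) :
    momPoly n (powVec n z) (M.mulVec p) = (M 0 0 - M 1 0 * z) ^ n * momPoly n (powVec n z') p := by
  rw [momPoly_powVec, momPoly_powVec, ← mul_pow]
  congr 1
  simp only [Matrix.mulVec, dotProduct, Fin.sum_univ_two]
  linear_combination -(p 1) * hz

/-- **The Möbius difference identity**: if `(a - cz)z' = dz - b`, `(a - cw)w' = dw - b` and
`ad - bc = 1`, then `(a - cz)(a - cw)(z' - w') = z - w`. [folklore] -/
theorem moebius_sub_mul (M : Matrix (Fin 2) (Fin 2) K) (hdet : M 0 0 * M 1 1 - M 0 1 * M 1 0 = 1)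
    {z z' w w' : K} (hz : (M 0 0 - M 1 0 * z) * z' = M 1 1 * z - M 0 1)
    (hw : (M 0 0 - M 1 0 * w) * w' = M 1 1 * w - M 0 1) :
    (M 0 0 - M 1 0 * z) * (M 0 0 - M 1 0 * w) * (z' - w') = z - w := by
  linear_combination (M 0 0 - M 1 0 * w) * hz - (M 0 0 - M 1 0 * z) * hw + (z - w) * hdet

/-- **Symmetry of the invariant form** for even `n`. [folklore] -/
theorem invForm_comm (hn : Even n) (x y : Fin (n + 1) → K) : invForm n x y = invForm n y x := by
  rw [invForm_apply, invForm_apply]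
  refine Fintype.sum_equiv Fin.revPerm _ _ fun j ↦ ?_
  have hj := fin_le j
  simp only [Fin.revPerm_apply, Fin.rev_rev, val_rev_eq]
  rw [Nat.choose_symm hj, neg_one_pow_sub_of_even hn hj]
  ring

/-- **Reproducing property**: `invForm x (e w) = momPoly x (w, 1)` (even `n`) — pairing with a pure
power is evaluation of the moment polynomial. [folklore] -/
theorem invForm_powVec_right (hn : Even n) (x : Fin (n + 1) → K) (w : K) :
    invForm n x (powVec n w) = momPoly n x ![w, 1] := by
  rw [invForm_apply, momPoly_apply]
  refine Finset.sum_congr rfl fun j _ ↦ ?_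
  have hj := fin_le j
  simp only [powVec_apply, val_rev_eq, Matrix.cons_val_one, Matrix.cons_val_zero, one_pow,
    mul_one]
  rw [neg_pow w, neg_one_pow_sub_of_even hn hj]
  ring

/-- **`invForm (e z) (e w) = (z - w)ⁿ`** (even `n`). [folklore] -/
theorem invForm_powVec_powVec (hn : Even n) (z w : K) :
    invForm n (powVec n z) (powVec n w) = (z - w) ^ n := by
  rw [invForm_powVec_right hn, momPoly_powVec]
  simp

/-- `invForm x (δ at rev j) = (-1)ʲ C(n,j) xⱼ`. [folklore] -/
theorem invForm_single_rev (x : Fin (n + 1) → K) (j : Fin (n + 1)) :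
    invForm n x (Pi.single (Fin.rev j) 1) = (-1) ^ (j : ℕ) * (n.choose j : K) * x j := by
  rw [invForm_apply, Finset.sum_eq_single j]
  · simp
  · intro i _ hij
    have : Fin.rev i ≠ Fin.rev j := fun h ↦ hij (Fin.rev_injective h)
    simp [this]
  · simp

/-- Double-sum expansion of the invariant form. [folklore] -/
theorem invForm_sum_sum {ι : Type*} (s : Finset ι) (u v : ι → Fin (n + 1) → K) :
    invForm n (∑ i ∈ s, u i) (∑ i ∈ s, v i) = ∑ i ∈ s, ∑ i' ∈ s, invForm n (u i) (v i') := by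
  rw [LinearMap.map_sum₂]
  refine Finset.sum_congr rfl fun i _ ↦ ?_
  rw [map_sum]

end MomentAlgebra

/-! ### §2. Separation and the relational invariance lemma (fields of characteristic `0`) -/

section MomentField

variable {K : Type*} [Field K] [CharZero K] {n : ℕ}

omit [CharZero K] in
/-- **Pure powers at `n + 1` distinct nodes form a basis of `Kⁿ⁺¹`** (Vandermonde). [folklore] -/
theorem linearIndependent_powVec {w : Fin (n + 1) → K} (hw : Injective w) :
    LinearIndependent K fun l ↦ powVec n (w l) := by
  have h : (Matrix.vandermonde w).det ≠ 0 := Matrix.det_vandermonde_ne_zero_iff.mpr hw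
  have e : (fun l ↦ powVec n (w l)) = fun i j ↦ Matrix.vandermonde w i j := by
    funext l j
    simp [Matrix.vandermonde_apply]
  rw [e]
  exact Matrix.linearIndependent_rows_of_det_ne_zero h

omit [CharZero K] in
/-- Every vector is a combination of the pure powers at `n + 1` distinct nodes. [folklore] -/
theorem exists_eq_sum_smul_powVec {w : Fin (n + 1) → K} (hw : Injective w)
    (x : Fin (n + 1) → K) : ∃ c : Fin (n + 1) → K, x = ∑ l, c l • powVec n (w l) := by
  set b := basisOfLinearIndependentOfCardEqFinrank (linearIndependent_powVec hw)
    (by simp) with hb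
  refine ⟨fun l ↦ b.repr x l, ?_⟩
  conv_lhs => rw [← b.sum_repr x]
  refine Finset.sum_congr rfl fun l _ ↦ ?_
  rw [hb, coe_basisOfLinearIndependentOfCardEqFinrank]

/-- **Separation**: a vector orthogonal (for `invForm`) to the pure powers at `n + 1` distinct
nodes is zero. [folklore] -/
theorem eq_zero_of_invForm_powVec_eq_zero {w : Fin (n + 1) → K} (hw : Injective w)
    {x : Fin (n + 1) → K} (h : ∀ l, invForm n x (powVec n (w l)) = 0) : x = 0 := by
  have hall : ∀ y, invForm n x y = 0 := by
    intro y
    obtain ⟨c, rfl⟩ := exists_eq_sum_smul_powVec hw y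
    rw [map_sum]
    refine Finset.sum_eq_zero fun l _ ↦ ?_
    rw [map_smul, h l, smul_zero]
  funext j
  have := hall (Pi.single (Fin.rev j) 1)
  rw [invForm_single_rev] at this
  have hC : ((n.choose j : ℕ) : K) ≠ 0 := by
    exact_mod_cast (Nat.choose_pos (fin_le j)).ne'
  have h1 : ((-1 : K) ^ (j : ℕ)) ≠ 0 := pow_ne_zero _ (neg_ne_zero.mpr one_ne_zero)
  simpa [hC, h1] using this

/-- **The moment polynomial determines the vector** (even `n`). [folklore] -/
theorem eq_zero_of_momPoly_eq_zero (hn : Even n) {x : Fin (n + 1) → K}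
    (h : ∀ p, momPoly n x p = 0) : x = 0 := by
  refine eq_zero_of_invForm_powVec_eq_zero (w := fun l : Fin (n + 1) ↦ (l : K))
    (fun a b hab ↦ ?_) fun l ↦ ?_
  · have h' : ((a : ℕ) : K) = (b : ℕ) := hab
    exact Fin.ext (by exact_mod_cast h')
  rw [invForm_powVec_right hn, h]

/-- Two vectors with the same moment polynomial are equal (even `n`). [folklore] -/
theorem eq_of_momPoly_eq (hn : Even n) {x y : Fin (n + 1) → K}
    (h : ∀ p, momPoly n x p = momPoly n y p) : x = y := by
  rw [← sub_eq_zero]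
  refine eq_zero_of_momPoly_eq_zero hn fun p ↦ ?_
  rw [map_sub, Pi.sub_apply, h, sub_self]

/-- **Relational invariance of `invForm`**: if `momPoly x ∘ M = momPoly y` for a matrix `M` of
determinant `1` then `invForm y y = invForm x x` (even `n`): the form
`∑ (-1)ʲ C(n,j) xⱼ x_{n-j}` is the `SL₂`-invariant pairing on `Symⁿ`. Proof: expand `x` in pure
powers `e(w_l)`; `e(w) ∘ M = (a - cw)ⁿ e(M⁻¹w)`, `invForm (e z) (e w) = (z - w)ⁿ`, and
`(a - cz)(a - cw)(M⁻¹z - M⁻¹w) = z - w`. [folklore] -/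
theorem invForm_eq_of_momPoly_mulVec (hn : Even n) (M : Matrix (Fin 2) (Fin 2) K)
    (hdet : M 0 0 * M 1 1 - M 0 1 * M 1 0 = 1) {x y : Fin (n + 1) → K}
    (h : ∀ p, momPoly n x (M.mulVec p) = momPoly n y p) : invForm n y y = invForm n x x := by
  classical
  -- nodes avoiding the pole `a - c w = 0`
  set w₀ : K := if M 1 0 = 0 then 0 else M 0 0 / M 1 0 + 1 with hw₀
  set w : Fin (n + 1) → K := fun l ↦ w₀ + l with hw
  have hwinj : Injective w := fun a b hab ↦ Fin.ext (by
    have : (a : K) = b := by simpa [hw] using hab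
    exact_mod_cast this)
  have hnz : ∀ l, M 0 0 - M 1 0 * w l ≠ 0 := by
    intro l
    simp only [hw, hw₀]
    split_ifs with hc
    · rw [hc, zero_mul, sub_zero]
      intro ha
      rw [ha, hc, zero_mul, mul_zero, sub_zero] at hdet
      exact zero_ne_one hdet
    · have hl : (1 + (l : K)) ≠ 0 := by
        have : (1 + (l : K)) = ((1 + (l : ℕ) : ℕ) : K) := by push_cast; ring
        rw [this, Nat.cast_ne_zero]
        omega
      intro h0
      apply hl
      have e : M 0 0 - M 1 0 * (M 0 0 / M 1 0 + 1 + (l : K)) = -(M 1 0) * (1 + (l : K)) := by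
        field_simp
        ring
      rw [e] at h0
      rcases mul_eq_zero.mp h0 with h1 | h1
      · exact absurd (neg_eq_zero.mp h1) hc
      · exact h1
  -- the transformed nodes
  set z : Fin (n + 1) → K := fun l ↦ (M 1 1 * w l - M 0 1) / (M 0 0 - M 1 0 * w l) with hz
  have hz' : ∀ l, (M 0 0 - M 1 0 * w l) * z l = M 1 1 * w l - M 0 1 := fun l ↦ by
    have h0 := hnz l
    simp only [hz]
    field_simp
  -- expand `x`
  obtain ⟨c, hc⟩ := exists_eq_sum_smul_powVec hwinj x
  set y' : Fin (n + 1) → K := ∑ l, (c l * (M 0 0 - M 1 0 * w l) ^ n) • powVec n (z l) with hy'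
  have hyy' : y = y' := by
    refine eq_of_momPoly_eq hn fun p ↦ ?_
    rw [← h p, hc, map_sum, hy', map_sum]
    simp only [map_smul, Finset.sum_apply, Pi.smul_apply, smul_eq_mul]
    refine Finset.sum_congr rfl fun l _ ↦ ?_
    rw [momPoly_powVec_mulVec M (hz' l) p]
    ring
  rw [hyy', hy', hc, invForm_sum_sum, invForm_sum_sum]
  refine Finset.sum_congr rfl fun l _ ↦ Finset.sum_congr rfl fun l' _ ↦ ?_
  simp only [map_smul, LinearMap.smul_apply, smul_eq_mul, invForm_powVec_powVec hn]
  have key := moebius_sub_mul M hdet (hz' l) (hz' l')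
  rw [← key, mul_pow, mul_pow]
  ring

end MomentField

/-! ### §3. Polynomial identities in two variables from their values on `ℤ²` -/

section Density

variable {n : ℕ}

/-- Along an affine line the moment polynomial is a polynomial in the parameter. [folklore] -/
theorem exists_polynomial_momPoly_affine {K : Type*} [CommRing K] (x : Fin (n + 1) → K)
    (a b : Fin 2 → K) :
    ∃ R : Polynomial K, ∀ t : K, momPoly n x (t • a + b) = R.eval t := by
  refine ⟨∑ j : Fin (n + 1), Polynomial.C ((n.choose j : K) * x j) *
      (Polynomial.C (a 1) * Polynomial.X + Polynomial.C (b 1)) ^ (j : ℕ) *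
      (-(Polynomial.C (a 0) * Polynomial.X + Polynomial.C (b 0))) ^ (n - j), fun t ↦ ?_⟩
  simp only [momPoly_apply, Polynomial.eval_finsetSum, Polynomial.eval_mul, Polynomial.eval_C,
    Polynomial.eval_pow, Polynomial.eval_neg, Polynomial.eval_X, Polynomial.eval_add,
    Pi.add_apply, Pi.smul_apply, smul_eq_mul]
  refine Finset.sum_congr rfl fun j _ ↦ ?_
  ring

/-- The real part of a complex polynomial on the real line is a real polynomial. [folklore] -/
theorem exists_polynomial_re_eval_ofReal (R : Polynomial ℂ) :
    ∃ R' : Polynomial ℝ, ∀ u : ℝ, (R.eval (u : ℂ)).re = R'.eval u := by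
  induction R using Polynomial.induction_on' with
  | add p q hp hq =>
    obtain ⟨P, hP⟩ := hp
    obtain ⟨Q, hQ⟩ := hq
    exact ⟨P + Q, fun u ↦ by rw [Polynomial.eval_add, Complex.add_re, hP, hQ, Polynomial.eval_add]⟩
  | monomial m c =>
    refine ⟨Polynomial.monomial m c.re, fun u ↦ ?_⟩
    rw [Polynomial.eval_monomial, Polynomial.eval_monomial, ← Complex.ofReal_pow, mul_comm,
      Complex.re_ofReal_mul, mul_comm]

/-- A real polynomial vanishing at all integers is zero. [folklore] -/
theorem Polynomial.eq_zero_of_forall_int_eval_eq_zero_real (R : Polynomial ℝ)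
    (h : ∀ m : ℤ, R.eval (m : ℝ) = 0) : R = 0 :=
  Polynomial.eq_zero_of_infinite_isRoot R
    ((Set.infinite_range_of_injective Int.cast_injective).mono (by
      rintro _ ⟨m, rfl⟩
      exact h m))

/-- **Density**: a function `D : ℝ → ℝ → ℝ` that is polynomial in each variable separately and
vanishes on `ℤ²` vanishes identically. [folklore] -/
theorem eq_zero_of_forall_int_of_polynomial {D : ℝ → ℝ → ℝ}
    (h₁ : ∀ v : ℝ, ∃ R : Polynomial ℝ, ∀ u, D u v = R.eval u)
    (h₂ : ∀ u : ℝ, ∃ R : Polynomial ℝ, ∀ v, D u v = R.eval v)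
    (h : ∀ a b : ℤ, D a b = 0) (u v : ℝ) : D u v = 0 := by
  have step : ∀ (b : ℤ) (u : ℝ), D u b = 0 := by
    intro b u
    obtain ⟨R, hR⟩ := h₁ b
    have hR0 : R = 0 :=
      Polynomial.eq_zero_of_forall_int_eval_eq_zero_real R fun m ↦ by rw [← hR, h]
    rw [hR, hR0, Polynomial.eval_zero]
  obtain ⟨R, hR⟩ := h₂ u
  have hR0 : R = 0 :=
    Polynomial.eq_zero_of_forall_int_eval_eq_zero_real R fun m ↦ by rw [← hR, step]
  rw [hR, hR0, Polynomial.eval_zero]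

end Density

/-! ### §4. Real moment vectors of a cusp form and their `Γ₀(N)`-equivariance -/

section RealMoments

variable {n : ℕ}

/-- Componentwise real part of a complex vector. [folklore] -/
def reVec (v : Fin (n + 1) → ℂ) : Fin (n + 1) → ℝ := fun j ↦ (v j).re

/-- Componentwise imaginary part of a complex vector. [folklore] -/
def imVec (v : Fin (n + 1) → ℂ) : Fin (n + 1) → ℝ := fun j ↦ (v j).im

/-- Unfolding `reVec`. [folklore] -/
@[simp] theorem reVec_apply (v : Fin (n + 1) → ℂ) (j : Fin (n + 1)) : reVec v j = (v j).re := rfl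

/-- Unfolding `imVec`. [folklore] -/
@[simp] theorem imVec_apply (v : Fin (n + 1) → ℂ) (j : Fin (n + 1)) : imVec v j = (v j).im := rfl

/-- **At a real point, the real part of the complex moment polynomial is the real moment polynomial
of the real parts.** [folklore] -/
theorem momPoly_ofReal_re (x : Fin (n + 1) → ℂ) (p : Fin 2 → ℝ) :
    (momPoly n x (fun i ↦ (p i : ℂ))).re = momPoly n (reVec x) p := by
  rw [momPoly_apply, momPoly_apply, Complex.re_sum]
  refine Finset.sum_congr rfl fun j _ ↦ ?_
  have : (n.choose j : ℂ) * x j * ((p 1 : ℝ) : ℂ) ^ (j : ℕ) * (-((p 0 : ℝ) : ℂ)) ^ (n - j) =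
      (((n.choose j : ℝ) * p 1 ^ (j : ℕ) * (-(p 0)) ^ (n - j) : ℝ) : ℂ) * x j := by
    push_cast
    ring
  rw [this, Complex.re_ofReal_mul, reVec_apply]
  ring

/-- The real matrix of `γ ∈ SL(2, ℤ)`. [folklore] -/
def rmat (γ : SL(2, ℤ)) : Matrix (Fin 2) (Fin 2) ℝ := (γ : Matrix (Fin 2) (Fin 2) ℤ).map (↑)

/-- Entries of the real matrix. [folklore] -/
@[simp] theorem rmat_apply (γ : SL(2, ℤ)) (i j : Fin 2) : rmat γ i j = ((γ i j : ℤ) : ℝ) := rfl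

/-- `det = 1` for the real matrix. [folklore] -/
theorem rmat_det (γ : SL(2, ℤ)) : rmat γ 0 0 * rmat γ 1 1 - rmat γ 0 1 * rmat γ 1 0 = 1 := by
  have := Matrix.SpecialLinearGroup.det_coe γ
  rw [Matrix.det_fin_two] at this
  simp only [rmat_apply]
  exact_mod_cast this

/-- The real matrix is multiplicative. [folklore] -/
theorem rmat_mul (γ δ : SL(2, ℤ)) : rmat (γ * δ) = rmat γ * rmat δ := by
  simp only [rmat, Matrix.SpecialLinearGroup.coe_mul]
  exact Matrix.map_mul (f := Int.castRingHom ℝ)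

/-- The real matrix of `1`. [folklore] -/
@[simp] theorem rmat_one : rmat 1 = 1 := by
  ext i j
  fin_cases i <;> fin_cases j <;> simp [rmat]

/-- Complex and real actions agree on real points. [folklore] -/
theorem icmat_mulVec_ofReal (γ : SL(2, ℤ)) (p : Fin 2 → ℝ) :
    (icmat γ).mulVec (fun i ↦ (p i : ℂ)) = fun i ↦ (((rmat γ).mulVec p) i : ℂ) := by
  funext i
  simp [Matrix.mulVec, dotProduct, Fin.sum_univ_two]

variable (n)

/-- The **moment vector** of a cusp function at `τ`: `(∫_τ^{i∞} φ(z) zʲ dz)ⱼ`. [folklore] -/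
def momVec (φ : ℍ → ℂ) (τ : ℍ) : Fin (n + 1) → ℂ := fun j ↦ powPrimitive j φ τ

/-- The Eichler–Shimura kernel is the moment polynomial of the moment vector. [folklore] -/
theorem eichlerKernel_eq_momPoly (φ : ℍ → ℂ) (τ : ℍ) (p : Fin 2 → ℂ) :
    eichlerKernel n φ τ p = momPoly n (momVec n φ τ) p := by
  rw [eichlerKernel, Finset.sum_range]
  rfl

variable {N : ℕ} [NeZero N]

/-- The **shifted real moment vector** `r(τ) = re (∫_τ^{i∞} f zʲ dz)ⱼ + x₀` of
`f ∈ S_{n+2}(Γ₀(N))`. [folklore] -/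
def rmomVec (f : CuspForm (Gamma0 N) (n + 2)) (x₀ : Fin (n + 1) → ℝ) (τ : ℍ) : Fin (n + 1) → ℝ :=
  reVec (momVec n f τ) + x₀

/-- The real-coboundary hypothesis on the periods (all real points): there is `x₀ ∈ ℝⁿ⁺¹` with
`re c_f(γ)(p) = momPoly x₀ (γ p) - momPoly x₀ p` for `γ ∈ Γ₀(N)`, `p ∈ ℝ²`. [folklore] -/
def IsReCoboundary (f : CuspForm (Gamma0 N) (n + 2)) (x₀ : Fin (n + 1) → ℝ) : Prop :=
  ∀ (γ : Gamma0 N) (p : Fin 2 → ℝ), (periodFn n f γ (fun i ↦ (p i : ℂ))).re =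
    momPoly n x₀ ((rmat γ).mulVec p) - momPoly n x₀ p

variable {n}

omit [NeZero N] in
/-- **Integer points suffice**: the real-coboundary identity on `ℤ²` implies it on `ℝ²` (both
sides are polynomial in each coordinate). [folklore] -/
theorem isReCoboundary_of_int (f : CuspForm (Gamma0 N) (n + 2)) (x₀ : Fin (n + 1) → ℝ)
    (h : ∀ (γ : Gamma0 N) (q : Fin 2 → ℤ), (periodFn n f γ (fun i ↦ (q i : ℂ))).re =
      momPoly n x₀ ((rmat γ).mulVec (fun i ↦ (q i : ℝ))) - momPoly n x₀ (fun i ↦ (q i : ℝ))) :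
    IsReCoboundary n f x₀ := by
  intro γ p
  -- `D(u, v) = re c(γ)(u, v) - momPoly x₀ (γ(u,v)) + momPoly x₀ (u, v)`
  set D : ℝ → ℝ → ℝ := fun u v ↦ (periodFn n f γ ![(u : ℂ), (v : ℂ)]).re -
    momPoly n x₀ ((rmat γ).mulVec ![u, v]) + momPoly n x₀ ![u, v] with hD
  have hline₁ : ∀ (t : ℝ) (v : ℝ), (t : ℂ) • ![(1 : ℂ), 0] + ![0, (v : ℂ)] = ![(t : ℂ), (v : ℂ)] :=
    fun t v ↦ by funext i; fin_cases i <;> simp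
  have hline₁' : ∀ (t : ℝ) (v : ℝ), t • ![(1 : ℝ), 0] + ![0, v] = ![t, v] :=
    fun t v ↦ by funext i; fin_cases i <;> simp
  have hline₂ : ∀ (u : ℝ) (t : ℝ), (t : ℂ) • ![(0 : ℂ), 1] + ![(u : ℂ), 0] = ![(u : ℂ), (t : ℂ)] :=
    fun u t ↦ by funext i; fin_cases i <;> simp
  have hline₂' : ∀ (u : ℝ) (t : ℝ), t • ![(0 : ℝ), 1] + ![u, 0] = ![u, t] :=
    fun u t ↦ by funext i; fin_cases i <;> simp
  have h₁ : ∀ v : ℝ, ∃ R : Polynomial ℝ, ∀ u, D u v = R.eval u := by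
    intro v
    obtain ⟨Rc, hRc⟩ := exists_polynomial_periodFn_affine f γ ![1, 0] ![0, (v : ℂ)]
    obtain ⟨R₁, hR₁⟩ := exists_polynomial_re_eval_ofReal Rc
    obtain ⟨R₂, hR₂⟩ := exists_polynomial_momPoly_affine (n := n) x₀ ((rmat γ).mulVec ![1, 0])
      ((rmat γ).mulVec ![0, v])
    obtain ⟨R₃, hR₃⟩ := exists_polynomial_momPoly_affine (n := n) x₀ ![1, 0] ![0, v]
    refine ⟨R₁ - R₂ + R₃, fun u ↦ ?_⟩
    simp only [hD, Polynomial.eval_add, Polynomial.eval_sub]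
    rw [← hR₁, ← hRc, hline₁, ← hR₃, hline₁', ← hR₂, ← Matrix.mulVec_smul,
      ← Matrix.mulVec_add, hline₁']
  have h₂ : ∀ u : ℝ, ∃ R : Polynomial ℝ, ∀ v, D u v = R.eval v := by
    intro u
    obtain ⟨Rc, hRc⟩ := exists_polynomial_periodFn_affine f γ ![0, 1] ![(u : ℂ), 0]
    obtain ⟨R₁, hR₁⟩ := exists_polynomial_re_eval_ofReal Rc
    obtain ⟨R₂, hR₂⟩ := exists_polynomial_momPoly_affine (n := n) x₀ ((rmat γ).mulVec ![0, 1])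
      ((rmat γ).mulVec ![u, 0])
    obtain ⟨R₃, hR₃⟩ := exists_polynomial_momPoly_affine (n := n) x₀ ![0, 1] ![u, 0]
    refine ⟨R₁ - R₂ + R₃, fun v ↦ ?_⟩
    simp only [hD, Polynomial.eval_add, Polynomial.eval_sub]
    rw [← hR₁, ← hRc, hline₂, ← hR₃, hline₂', ← hR₂, ← Matrix.mulVec_smul,
      ← Matrix.mulVec_add, hline₂']
  have hint : ∀ a b : ℤ, D a b = 0 := by
    intro a b
    have := h γ ![a, b]
    have e1 : (fun i ↦ ((![a, b] : Fin 2 → ℤ) i : ℂ)) = ![((a : ℝ) : ℂ), ((b : ℝ) : ℂ)] := by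
      funext i; fin_cases i <;> simp
    have e2 : (fun i ↦ ((![a, b] : Fin 2 → ℤ) i : ℝ)) = ![(a : ℝ), (b : ℝ)] := by
      funext i; fin_cases i <;> simp
    rw [e1, e2] at this
    simp only [hD, this]
    ring
  have hp : (fun i ↦ (p i : ℂ)) = ![((p 0 : ℝ) : ℂ), ((p 1 : ℝ) : ℂ)] := by
    funext i; fin_cases i <;> simp
  have hp' : p = ![p 0, p 1] := by funext i; fin_cases i <;> simp
  have := eq_zero_of_forall_int_of_polynomial h₁ h₂ hint (p 0) (p 1)
  simp only [hD] at this
  have e3 : (rmat γ).mulVec p = (rmat γ).mulVec ![p 0, p 1] := by rw [← hp']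
  have e4 : momPoly n x₀ p = momPoly n x₀ ![p 0, p 1] := by rw [← hp']
  rw [hp, e3, e4]
  linarith

variable (n)

/-- **Equivariance of the shifted real moment vector**: under the real-coboundary hypothesis,
`momPoly (r(γτ)) (γ p) = momPoly (r(τ)) p` for `γ ∈ Γ₀(N)` — the real part of the
transformation law `K(γτ, γp) = K(τ, p) - c(γ)(p)` (`periodFn_eq_of_mem`). [folklore] -/
theorem momPoly_rmomVec_smul (f : CuspForm (Gamma0 N) (n + 2)) (x₀ : Fin (n + 1) → ℝ)
    (hre : IsReCoboundary n f x₀) (γ : Gamma0 N) (τ : ℍ) (p : Fin 2 → ℝ) :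
    momPoly n (rmomVec n f x₀ ((γ : SL(2, ℤ)) • τ)) ((rmat γ).mulVec p) =
      momPoly n (rmomVec n f x₀ τ) p := by
  have key := periodFn_eq_of_mem f γ (fun i ↦ (p i : ℂ)) τ
  rw [icmat_mulVec_ofReal, eichlerKernel_eq_momPoly, eichlerKernel_eq_momPoly] at key
  have hk := congrArg Complex.re key
  rw [hre, Complex.sub_re, momPoly_ofReal_re, momPoly_ofReal_re] at hk
  simp only [rmomVec, map_add, Pi.add_apply]
  linarith

/-- **The invariant function** `Q(τ) = (-1)^{n/2} B(r(τ), r(τ))`, `B = invForm`,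
`r = rmomVec`. [folklore] -/
def qInv (f : CuspForm (Gamma0 N) (n + 2)) (x₀ : Fin (n + 1) → ℝ) (τ : ℍ) : ℝ :=
  (-1) ^ (n / 2) * invForm n (rmomVec n f x₀ τ) (rmomVec n f x₀ τ)

/-- **`Q` is `Γ₀(N)`-invariant** (even `n`): the real moment vector is `Γ₀(N)`-equivariant and
`invForm` is `SL₂`-invariant. [folklore] -/
theorem qInv_smul (hn : Even n) (f : CuspForm (Gamma0 N) (n + 2)) (x₀ : Fin (n + 1) → ℝ)
    (hre : IsReCoboundary n f x₀) (γ : Gamma0 N) (τ : ℍ) :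
    qInv n f x₀ ((γ : SL(2, ℤ)) • τ) = qInv n f x₀ τ := by
  unfold qInv
  rw [invForm_eq_of_momPoly_mulVec hn (rmat γ) (rmat_det γ)
    (fun p ↦ momPoly_rmomVec_smul n f x₀ hre γ τ p)]

end RealMoments

/-! ### §5. Calculus: the line second-derivative test and the Laplacian of `B(re G + x₀, re G + x₀)` -/

section Calculus

/-- **Second-derivative test on a line**: if `h` has a local maximum at `0`, is differentiable
near `0` with derivative `h'`, and `h'` is differentiable at `0` with derivative `h''`, then
`h'' ≤ 0` (Mathlib's `isLocalMin_of_deriv_deriv_pos`: otherwise `0` is also a local minimum, so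
`h` is locally constant and `h'' = 0`). [folklore] -/
theorem second_deriv_nonpos_of_isLocalMax {h h' : ℝ → ℝ} {h'' : ℝ} (hmax : IsLocalMax h 0)
    (hd : ∀ᶠ t in 𝓝 0, HasDerivAt h (h' t) t) (hd2 : HasDerivAt h' h'' 0) : h'' ≤ 0 := by
  by_contra hpos
  push Not at hpos
  have hderiv : deriv h =ᶠ[𝓝 0] h' := hd.mono fun t ht ↦ ht.deriv
  have hdd : deriv (deriv h) 0 = h'' := by rw [hderiv.deriv_eq]; exact hd2.deriv
  have hd0 : deriv h 0 = 0 := hmax.deriv_eq_zero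
  have hcont : ContinuousAt h 0 := hd.self_of_nhds.continuousAt
  have hmin : IsLocalMin h 0 :=
    isLocalMin_of_deriv_deriv_pos (by rw [hdd]; exact hpos) hd0 hcont
  have hconst : ∀ᶠ t in 𝓝 0, h t = h 0 := by
    filter_upwards [hmax, hmin] with t h1 h2 using le_antisymm h1 h2
  have h'0 : ∀ᶠ t in 𝓝 0, h' t = 0 := by
    filter_upwards [hconst.eventually_nhds, hd] with t ht hdt
    exact hdt.unique ((hasDerivAt_const t (h 0)).congr_of_eventuallyEq ht)
  have h0 : HasDerivAt h' 0 0 := (hasDerivAt_const (0 : ℝ) (0 : ℝ)).congr_of_eventuallyEq h'0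
  exact absurd (hd2.unique h0) hpos.ne'

/-- Complex chain rule along the line `w ↦ w₀ + wξ`. [folklore] -/
theorem hasDerivAt_comp_line {Gc : ℂ → ℂ} {d : ℂ} (w₀ ξ : ℂ) {t : ℝ}
    (h : HasDerivAt Gc d (w₀ + t * ξ)) :
    HasDerivAt (fun w : ℂ ↦ Gc (w₀ + w * ξ)) (d * ξ) (t : ℂ) := by
  have hc : HasDerivAt (fun w : ℂ ↦ w₀ + w * ξ) ξ (t : ℂ) := by
    simpa using ((hasDerivAt_id (t : ℂ)).mul_const ξ).const_add w₀
  exact h.comp (t : ℂ) hc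

variable {n : ℕ}

/-- `B(re v, re v) + B(im v, im v) = re B_ℂ(v, v̄)`. [folklore] -/
theorem invForm_reVec_add_imVec (v : Fin (n + 1) → ℂ) :
    invForm n (reVec v) (reVec v) + invForm n (imVec v) (imVec v) =
      (invForm n v (star v)).re := by
  rw [invForm_apply, invForm_apply, invForm_apply, Complex.re_sum, ← Finset.sum_add_distrib]
  refine Finset.sum_congr rfl fun j _ ↦ ?_
  have h1 : ((-1 : ℂ) ^ (j : ℕ) * (n.choose j : ℂ)) =
      (((-1 : ℝ) ^ (j : ℕ) * (n.choose j : ℝ) : ℝ) : ℂ) := by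
    push_cast; ring
  rw [show (-1 : ℂ) ^ (j : ℕ) * (n.choose j : ℂ) * v j * star v (Fin.rev j) =
      ((-1 : ℂ) ^ (j : ℕ) * (n.choose j : ℂ)) * (v j * star v (Fin.rev j)) by ring, h1,
    Complex.re_ofReal_mul]
  simp only [reVec_apply, imVec_apply, Pi.star_apply, Complex.star_def, Complex.mul_re,
    Complex.conj_re, Complex.conj_im]
  ring

/-- **The line second derivatives of `σ B(re G + x₀, re G + x₀) + P`** along `t ↦ w₀ + tξ`
(`P` a real quadratic in `re w`, `im w`): existence near `0` and the value at `0`. [folklore] -/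
theorem hasDerivAt_line (σ : ℝ) (x₀ : Fin (n + 1) → ℝ) (G G' : ℂ → Fin (n + 1) → ℂ)
    (G'' : Fin (n + 1) → ℂ) (w₀ ξ : ℂ)
    (hG : ∀ᶠ w in 𝓝 w₀, ∀ j, HasDerivAt (fun w ↦ G w j) (G' w j) w)
    (hG'' : ∀ j, HasDerivAt (fun w ↦ G' w j) (G'' j) w₀) (A B C D E : ℝ) :
    let R : ℂ → Fin (n + 1) → ℝ := fun w ↦ reVec (G w) + x₀
    let F : ℂ → ℝ := fun w ↦ σ * invForm n (R w) (R w) +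
      (A * w.re ^ 2 + B * w.im ^ 2 + C * w.re + D * w.im + E)
    let h' : ℝ → ℝ := fun t ↦ σ * ∑ j : Fin (n + 1), (-1) ^ (j : ℕ) * (n.choose j : ℝ) *
        ((G' (w₀ + (t : ℂ) * ξ) j * ξ).re * R (w₀ + (t : ℂ) * ξ) (Fin.rev j) +
          R (w₀ + (t : ℂ) * ξ) j * (G' (w₀ + (t : ℂ) * ξ) (Fin.rev j) * ξ).re) +
      (2 * A * (w₀.re + t * ξ.re) * ξ.re + C * ξ.re + 2 * B * (w₀.im + t * ξ.im) * ξ.im + D * ξ.im)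
    let h'' : ℝ := σ * ∑ j : Fin (n + 1), (-1) ^ (j : ℕ) * (n.choose j : ℝ) *
        ((G'' j * ξ * ξ).re * R w₀ (Fin.rev j) +
          2 * ((G' w₀ j * ξ).re * (G' w₀ (Fin.rev j) * ξ).re) +
          R w₀ j * (G'' (Fin.rev j) * ξ * ξ).re) +
      (2 * A * ξ.re * ξ.re + 2 * B * ξ.im * ξ.im)
    (∀ᶠ t : ℝ in 𝓝 0, HasDerivAt (fun s : ℝ ↦ F (w₀ + (s : ℂ) * ξ)) (h' t) t) ∧
      HasDerivAt h' h'' 0 := by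
  intro R F h' h''
  -- the curve and the transported hypothesis
  have hc : Continuous fun t : ℝ ↦ w₀ + (t : ℂ) * ξ := by fun_prop
  have hct : Tendsto (fun t : ℝ ↦ w₀ + (t : ℂ) * ξ) (𝓝 0) (𝓝 w₀) := by
    simpa using hc.tendsto 0
  have hGt : ∀ᶠ t : ℝ in 𝓝 0, ∀ j,
      HasDerivAt (fun w ↦ G w j) (G' (w₀ + (t : ℂ) * ξ) j) (w₀ + (t : ℂ) * ξ) :=
    hct.eventually hG
  -- components of `R` along the curve
  have hR : ∀ᶠ t : ℝ in 𝓝 0, ∀ j,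
      HasDerivAt (fun s : ℝ ↦ R (w₀ + (s : ℂ) * ξ) j) ((G' (w₀ + (t : ℂ) * ξ) j * ξ).re) t := by
    filter_upwards [hGt] with t ht j
    have := (hasDerivAt_comp_line w₀ ξ (ht j)).real_of_complex
    simpa [R] using this.add_const (x₀ j)
  constructor
  · filter_upwards [hR] with t ht
    -- the quadratic form part
    have hQ : HasDerivAt (fun s : ℝ ↦ σ * invForm n (R (w₀ + (s : ℂ) * ξ)) (R (w₀ + (s : ℂ) * ξ)))
        (σ * ∑ j : Fin (n + 1), (-1) ^ (j : ℕ) * (n.choose j : ℝ) *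
          ((G' (w₀ + (t : ℂ) * ξ) j * ξ).re * R (w₀ + (t : ℂ) * ξ) (Fin.rev j) +
            R (w₀ + (t : ℂ) * ξ) j * (G' (w₀ + (t : ℂ) * ξ) (Fin.rev j) * ξ).re)) t := by
      simp only [invForm_apply]
      refine HasDerivAt.const_mul σ (HasDerivAt.fun_sum fun j _ ↦ ?_)
      have := (((ht j).const_mul ((-1) ^ (j : ℕ) * (n.choose j : ℝ))).mul (ht (Fin.rev j)))
      refine this.congr_deriv ?_
      ring
    -- the polynomial part
    have hP : HasDerivAt (fun s : ℝ ↦ A * (w₀ + (s : ℂ) * ξ).re ^ 2 + B * (w₀ + (s : ℂ) * ξ).im ^ 2 +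
        C * (w₀ + (s : ℂ) * ξ).re + D * (w₀ + (s : ℂ) * ξ).im + E)
        (2 * A * (w₀.re + t * ξ.re) * ξ.re + C * ξ.re + 2 * B * (w₀.im + t * ξ.im) * ξ.im +
          D * ξ.im) t := by
      have e : (fun s : ℝ ↦ A * (w₀ + (s : ℂ) * ξ).re ^ 2 + B * (w₀ + (s : ℂ) * ξ).im ^ 2 +
          C * (w₀ + (s : ℂ) * ξ).re + D * (w₀ + (s : ℂ) * ξ).im + E) = fun s : ℝ ↦
          A * (w₀.re + s * ξ.re) ^ 2 + B * (w₀.im + s * ξ.im) ^ 2 + C * (w₀.re + s * ξ.re) +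
            D * (w₀.im + s * ξ.im) + E := by
        funext s; simp
      rw [e]
      have h1 : HasDerivAt (fun s : ℝ ↦ w₀.re + s * ξ.re) ξ.re t := by
        simpa using ((hasDerivAt_id t).mul_const ξ.re).const_add w₀.re
      have h2 : HasDerivAt (fun s : ℝ ↦ w₀.im + s * ξ.im) ξ.im t := by
        simpa using ((hasDerivAt_id t).mul_const ξ.im).const_add w₀.im
      have := ((((h1.pow 2).const_mul A).add ((h2.pow 2).const_mul B)).add
        (h1.const_mul C)).add (h2.const_mul D) |>.add_const E
      refine this.congr_deriv ?_
      simp only [Nat.cast_ofNat, Nat.add_one_sub_one, pow_one]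
      ring
    exact hQ.add hP
  · -- second derivative at `0`
    have hR0 : ∀ j, HasDerivAt (fun s : ℝ ↦ R (w₀ + (s : ℂ) * ξ) j) ((G' w₀ j * ξ).re) 0 := by
      intro j
      have := hR.self_of_nhds j
      simpa using this
    have hG'0 : ∀ j, HasDerivAt (fun s : ℝ ↦ (G' (w₀ + (s : ℂ) * ξ) j * ξ).re)
        ((G'' j * ξ * ξ).re) 0 := by
      intro j
      have h1 := hasDerivAt_comp_line w₀ ξ (t := 0) (by simpa using hG'' j)
      exact (h1.mul_const ξ).real_of_complex
    have hQ : HasDerivAt (fun t : ℝ ↦ σ * ∑ j : Fin (n + 1), (-1) ^ (j : ℕ) * (n.choose j : ℝ) *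
          ((G' (w₀ + (t : ℂ) * ξ) j * ξ).re * R (w₀ + (t : ℂ) * ξ) (Fin.rev j) +
            R (w₀ + (t : ℂ) * ξ) j * (G' (w₀ + (t : ℂ) * ξ) (Fin.rev j) * ξ).re))
        (σ * ∑ j : Fin (n + 1), (-1) ^ (j : ℕ) * (n.choose j : ℝ) *
          ((G'' j * ξ * ξ).re * R w₀ (Fin.rev j) +
            2 * ((G' w₀ j * ξ).re * (G' w₀ (Fin.rev j) * ξ).re) +
            R w₀ j * (G'' (Fin.rev j) * ξ * ξ).re)) 0 := by
      refine HasDerivAt.const_mul σ (HasDerivAt.fun_sum fun j _ ↦ ?_)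
      have := (((hG'0 j).mul (hR0 (Fin.rev j))).add ((hR0 j).mul (hG'0 (Fin.rev j)))).const_mul
        ((-1) ^ (j : ℕ) * (n.choose j : ℝ))
      refine this.congr_deriv ?_
      simp only [Complex.ofReal_zero, zero_mul, add_zero]
      ring
    have hP : HasDerivAt (fun t : ℝ ↦ 2 * A * (w₀.re + t * ξ.re) * ξ.re + C * ξ.re +
        2 * B * (w₀.im + t * ξ.im) * ξ.im + D * ξ.im)
        (2 * A * ξ.re * ξ.re + 2 * B * ξ.im * ξ.im) 0 := by
      have h1 : HasDerivAt (fun s : ℝ ↦ w₀.re + s * ξ.re) ξ.re 0 := by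
        simpa using ((hasDerivAt_id (0 : ℝ)).mul_const ξ.re).const_add w₀.re
      have h2 : HasDerivAt (fun s : ℝ ↦ w₀.im + s * ξ.im) ξ.im 0 := by
        simpa using ((hasDerivAt_id (0 : ℝ)).mul_const ξ.im).const_add w₀.im
      have := ((((h1.const_mul (2 * A)).mul_const ξ.re).add_const (C * ξ.re)).add
        ((h2.const_mul (2 * B)).mul_const ξ.im)).add_const (D * ξ.im)
      refine this.congr_deriv ?_
      ring
    exact hQ.add hP

/-- **The subharmonicity inequality at a local maximum.** Let `G : ℂ → ℂⁿ⁺¹` be holomorphic near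
`w₀` with derivative `G'`, itself differentiable at `w₀`, and suppose
`w ↦ σ B(re G(w) + x₀, re G(w) + x₀) + (A re² + B im² + C re + D im + E)` has a local maximum at
`w₀`. Then `2σ re B_ℂ(G'(w₀), conj G'(w₀)) + 2A + 2B ≤ 0` — the sum of the two line second
derivatives (the Laplacian), each `≤ 0` at a maximum; the holomorphy makes the `G''`-terms of the
horizontal and vertical directions cancel (`B` is applied to the real part of a holomorphic
vector, whose components are harmonic). [folklore] -/
theorem laplace_nonpos_of_isLocalMax (σ : ℝ) (x₀ : Fin (n + 1) → ℝ) (G G' : ℂ → Fin (n + 1) → ℂ)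
    (w₀ : ℂ) (hG : ∀ᶠ w in 𝓝 w₀, ∀ j, HasDerivAt (fun w ↦ G w j) (G' w j) w)
    (hG' : ∀ j, DifferentiableAt ℂ (fun w ↦ G' w j) w₀) (A B C D E : ℝ)
    (hmax : IsLocalMax (fun w ↦ σ * invForm n (reVec (G w) + x₀) (reVec (G w) + x₀) +
      (A * w.re ^ 2 + B * w.im ^ 2 + C * w.re + D * w.im + E)) w₀) :
    2 * σ * (invForm n (G' w₀) (star (G' w₀))).re + 2 * A + 2 * B ≤ 0 := by
  set G'' : Fin (n + 1) → ℂ := fun j ↦ deriv (fun w ↦ G' w j) w₀ with hG''def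
  have hG'' : ∀ j, HasDerivAt (fun w ↦ G' w j) (G'' j) w₀ := fun j ↦ (hG' j).hasDerivAt
  set F : ℂ → ℝ := fun w ↦ σ * invForm n (reVec (G w) + x₀) (reVec (G w) + x₀) +
      (A * w.re ^ 2 + B * w.im ^ 2 + C * w.re + D * w.im + E) with hF
  -- local maxima along the two lines
  have hline : ∀ ξ : ℂ, IsLocalMax (fun s : ℝ ↦ F (w₀ + (s : ℂ) * ξ)) 0 := by
    intro ξ
    have hc : Continuous fun t : ℝ ↦ w₀ + (t : ℂ) * ξ := by fun_prop
    have hct : Tendsto (fun t : ℝ ↦ w₀ + (t : ℂ) * ξ) (𝓝 0) (𝓝 (w₀ + ((0 : ℝ) : ℂ) * ξ)) :=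
      hc.tendsto 0
    have h0 : w₀ + ((0 : ℝ) : ℂ) * ξ = w₀ := by simp
    have hmax' : IsMaxFilter F (𝓝 (w₀ + ((0 : ℝ) : ℂ) * ξ)) (w₀ + ((0 : ℝ) : ℂ) * ξ) := by
      rw [h0]; exact hmax
    exact IsMaxFilter.comp_tendsto (g := fun t : ℝ ↦ w₀ + (t : ℂ) * ξ) hmax' hct
  obtain ⟨h1, h1'⟩ := hasDerivAt_line σ x₀ G G' G'' w₀ 1 hG hG'' A B C D E
  obtain ⟨h2, h2'⟩ := hasDerivAt_line σ x₀ G G' G'' w₀ Complex.I hG hG'' A B C D E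
  set R₀ : Fin (n + 1) → ℝ := reVec (G w₀) + x₀ with hR₀
  have i1 : σ * ∑ j : Fin (n + 1), (-1) ^ (j : ℕ) * (n.choose j : ℝ) *
        ((G'' j * 1 * 1).re * R₀ (Fin.rev j) +
          2 * ((G' w₀ j * 1).re * (G' w₀ (Fin.rev j) * 1).re) +
          R₀ j * (G'' (Fin.rev j) * 1 * 1).re) +
      (2 * A * (1 : ℂ).re * (1 : ℂ).re + 2 * B * (1 : ℂ).im * (1 : ℂ).im) ≤ 0 :=
    second_deriv_nonpos_of_isLocalMax (hline 1) h1 h1'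
  have i2 : σ * ∑ j : Fin (n + 1), (-1) ^ (j : ℕ) * (n.choose j : ℝ) *
        ((G'' j * Complex.I * Complex.I).re * R₀ (Fin.rev j) +
          2 * ((G' w₀ j * Complex.I).re * (G' w₀ (Fin.rev j) * Complex.I).re) +
          R₀ j * (G'' (Fin.rev j) * Complex.I * Complex.I).re) +
      (2 * A * Complex.I.re * Complex.I.re + 2 * B * Complex.I.im * Complex.I.im) ≤ 0 :=
    second_deriv_nonpos_of_isLocalMax (hline Complex.I) h2 h2'
  have hsum : 2 * (invForm n (G' w₀) (star (G' w₀))).re =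
      (∑ j : Fin (n + 1), (-1) ^ (j : ℕ) * (n.choose j : ℝ) *
        ((G'' j * 1 * 1).re * R₀ (Fin.rev j) +
          2 * ((G' w₀ j * 1).re * (G' w₀ (Fin.rev j) * 1).re) +
          R₀ j * (G'' (Fin.rev j) * 1 * 1).re)) +
      (∑ j : Fin (n + 1), (-1) ^ (j : ℕ) * (n.choose j : ℝ) *
        ((G'' j * Complex.I * Complex.I).re * R₀ (Fin.rev j) +
          2 * ((G' w₀ j * Complex.I).re * (G' w₀ (Fin.rev j) * Complex.I).re) +
          R₀ j * (G'' (Fin.rev j) * Complex.I * Complex.I).re)) := by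
    rw [← invForm_reVec_add_imVec, invForm_apply, invForm_apply, ← Finset.sum_add_distrib,
      ← Finset.sum_add_distrib, Finset.mul_sum]
    refine Finset.sum_congr rfl fun j _ ↦ ?_
    simp only [mul_one, Complex.mul_I_re, Complex.mul_I_im, reVec_apply, imVec_apply]
    ring
  have hc1 : 2 * A * (1 : ℂ).re * (1 : ℂ).re + 2 * B * (1 : ℂ).im * (1 : ℂ).im = 2 * A := by simp
  have hc2 : 2 * A * Complex.I.re * Complex.I.re + 2 * B * Complex.I.im * Complex.I.im = 2 * B := by
    simp
  have e : 2 * σ * (invForm n (G' w₀) (star (G' w₀))).re + 2 * A + 2 * B =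
      (σ * ∑ j : Fin (n + 1), (-1) ^ (j : ℕ) * (n.choose j : ℝ) *
        ((G'' j * 1 * 1).re * R₀ (Fin.rev j) +
          2 * ((G' w₀ j * 1).re * (G' w₀ (Fin.rev j) * 1).re) +
          R₀ j * (G'' (Fin.rev j) * 1 * 1).re) +
      (2 * A * (1 : ℂ).re * (1 : ℂ).re + 2 * B * (1 : ℂ).im * (1 : ℂ).im)) +
      (σ * ∑ j : Fin (n + 1), (-1) ^ (j : ℕ) * (n.choose j : ℝ) *
        ((G'' j * Complex.I * Complex.I).re * R₀ (Fin.rev j) +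
          2 * ((G' w₀ j * Complex.I).re * (G' w₀ (Fin.rev j) * Complex.I).re) +
          R₀ j * (G'' (Fin.rev j) * Complex.I * Complex.I).re) +
      (2 * A * Complex.I.re * Complex.I.re + 2 * B * Complex.I.im * Complex.I.im)) := by
    linear_combination σ * hsum - hc1 - hc2
  rw [e]
  exact add_nonpos i1 i2

end Calculus

/-! ### §6. The translated moment vectors `w ↦ a(g • w)`: holomorphy and the Laplacian -/

section Translates

variable {N : ℕ} [NeZero N] (n : ℕ) (f : CuspForm (Gamma0 N) (n + 2)) (g : SL(2, ℤ))

/-- `moebius 1 = id`. [folklore] -/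
@[simp] theorem moebius_one (z : ℂ) : moebius 1 z = z := by
  simp [moebius]

/-- The **translated moment vector** `G_g(w) = (∫_{g w}^{i∞} f(z) zʲ dz)ⱼ` on `ℂ`
(for `im w > 0`). [folklore] -/
def momVecSlash (w : ℂ) : Fin (n + 1) → ℂ := momVec n f (g • ofComplex w)

/-- The scalar factor `-f(g w) (cw + d)⁻²`. [folklore] -/
def dFactor (w : ℂ) : ℂ :=
  -(f (ofComplex (moebius g w)) * (1 / (((g 1 0 : ℤ) : ℂ) * w + ((g 1 1 : ℤ) : ℂ)) ^ 2))

/-- The derivative of the translated moment vector. [folklore] -/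
def momVecSlash' (w : ℂ) : Fin (n + 1) → ℂ := fun j ↦
  -(f (ofComplex (moebius g w)) * moebius g w ^ (j : ℕ)) *
    (1 / (((g 1 0 : ℤ) : ℂ) * w + ((g 1 1 : ℤ) : ℂ)) ^ 2)

omit [NeZero N] in
/-- `G_g' = dFactor • e(g w)`. [folklore] -/
theorem momVecSlash'_eq (w : ℂ) :
    momVecSlash' n f g w = dFactor n f g w • powVec n (moebius g w) := by
  funext j
  simp only [momVecSlash', dFactor, Pi.smul_apply, powVec_apply, smul_eq_mul]
  ring

/-- **Holomorphy of the translated moment vector**: `d/dw G_g(w)ⱼ = -f(gw)(gw)ʲ (cw + d)⁻²`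
(`hasDerivAt_powPrimitive` and the chain rule for `w ↦ g w`). [folklore] -/
theorem hasDerivAt_momVecSlash {w : ℂ} (hw : 0 < w.im) (j : Fin (n + 1)) :
    HasDerivAt (fun w ↦ momVecSlash n f g w j) (momVecSlash' n f g w j) w := by
  have H := ((isCuspFunction_one f).hasDerivAt_powPrimitive j (moebius_im_pos g hw)).comp w
    (hasDerivAt_moebius g hw)
  refine H.congr_of_eventuallyEq ?_
  filter_upwards [isOpen_upperHalfPlaneSet.mem_nhds hw] with w' hw'
  simp only [momVecSlash, momVec, Function.comp_apply, smul_ofComplex g hw']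

/-- The same, eventually near a point of the upper half-plane. [folklore] -/
theorem eventually_hasDerivAt_momVecSlash {w₀ : ℂ} (hw₀ : 0 < w₀.im) :
    ∀ᶠ w in 𝓝 w₀, ∀ j, HasDerivAt (fun w ↦ momVecSlash n f g w j) (momVecSlash' n f g w j) w := by
  filter_upwards [isOpen_upperHalfPlaneSet.mem_nhds hw₀] with w hw j
  exact hasDerivAt_momVecSlash n f g hw j

/-- The derivative of the translated moment vector is again holomorphic. [folklore] -/
theorem differentiableAt_momVecSlash' {w₀ : ℂ} (hw₀ : 0 < w₀.im) (j : Fin (n + 1)) :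
    DifferentiableAt ℂ (fun w ↦ momVecSlash' n f g w j) w₀ := by
  have hd : DifferentiableOn ℂ (⇑f ∘ ofComplex) {z : ℂ | 0 < z.im} :=
    UpperHalfPlane.mdifferentiable_iff.mp (isCuspFunction_one f).mdifferentiable
  have hm : DifferentiableAt ℂ (moebius g) w₀ := (hasDerivAt_moebius g hw₀).differentiableAt
  have hF : DifferentiableAt ℂ (fun w ↦ f (ofComplex (moebius g w))) w₀ :=
    (hd.differentiableAt (isOpen_upperHalfPlaneSet.mem_nhds (moebius_im_pos g hw₀))).comp w₀ hm
  have hden : ((g 1 0 : ℤ) : ℂ) * w₀ + ((g 1 1 : ℤ) : ℂ) ≠ 0 := moebius_denom_ne_zero g hw₀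
  have h2 : DifferentiableAt ℂ (fun w : ℂ ↦ 1 / (((g 1 0 : ℤ) : ℂ) * w + ((g 1 1 : ℤ) : ℂ)) ^ 2)
      w₀ := by
    refine (differentiableAt_const (1 : ℂ)).div ?_ (pow_ne_zero 2 hden)
    fun_prop
  exact ((hF.mul (hm.pow _)).neg).mul h2

/-- `(-1)ᵐ (-1)ᵐ = 1`. [folklore] -/
theorem neg_one_pow_mul_self (m : ℕ) : (-1 : ℝ) ^ m * (-1) ^ m = 1 := by
  rw [← pow_add, ← two_mul, pow_mul]
  simp

omit [NeZero N] in
/-- **The Laplacian of `(-1)^{n/2} B(re G_g + x₀, re G_g + x₀)` is `2|f(gw)|²|cw+d|⁻⁴(2 im gw)ⁿ ≥ 0`**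
— its `re B_ℂ(G', Ḡ')`-part: `(-1)^{n/2} re B_ℂ(G_g', conj G_g') = |dFactor|² (2 im(g w))ⁿ`, from
`B(e(ζ), e(ζ̄)) = (ζ - ζ̄)ⁿ = (2i im ζ)ⁿ` (even `n`). [folklore] -/
theorem laplacian_momVecSlash (hn : Even n) (w : ℂ) :
    (-1 : ℝ) ^ (n / 2) * (invForm n (momVecSlash' n f g w) (star (momVecSlash' n f g w))).re =
      Complex.normSq (dFactor n f g w) * (2 * (moebius g w).im) ^ n := by
  rw [momVecSlash'_eq]
  set c : ℂ := dFactor n f g w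
  set ζ : ℂ := moebius g w
  have hn' := hn
  obtain ⟨m, hm⟩ := hn'
  have hn2 : n / 2 = m := by omega
  have hstar : star (c • powVec n ζ) = (starRingEnd ℂ c) • powVec n (starRingEnd ℂ ζ) := by
    funext j
    simp [powVec]
  have hI : Complex.I ^ n = (((-1 : ℝ) ^ m : ℝ) : ℂ) := by
    rw [hm, pow_add, ← mul_pow, Complex.I_mul_I]
    push_cast
    ring
  have key : c * ((starRingEnd ℂ) c * ((((2 * ζ.im : ℝ) : ℂ) * Complex.I) ^ n)) =
      ((Complex.normSq c * (2 * ζ.im) ^ n * (-1) ^ m : ℝ) : ℂ) := by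
    rw [mul_pow, hI, ← mul_assoc, Complex.mul_conj]
    push_cast
    ring
  rw [hstar, LinearMap.map_smul₂, map_smul, smul_eq_mul, smul_eq_mul, invForm_powVec_powVec hn,
    Complex.sub_conj, key, Complex.ofReal_re, hn2]
  have := neg_one_pow_mul_self m
  linear_combination (Complex.normSq c * (2 * ζ.im) ^ n) * this

variable (x₀ : Fin (n + 1) → ℝ)

/-- **`Q` seen from the cusp `g∞`**: `Q_g(w) = Q(g • w)`. [folklore] -/
def qSlash (w : ℂ) : ℝ := qInv n f x₀ (g • ofComplex w)

omit [NeZero N] in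
/-- `Q_g` in terms of the translated moment vector. [folklore] -/
theorem qSlash_eq (w : ℂ) : qSlash n f g x₀ w = (-1) ^ (n / 2) *
    invForm n (reVec (momVecSlash n f g w) + x₀) (reVec (momVecSlash n f g w) + x₀) := rfl

/-- The quadratic form `y ↦ B(y, y)` is continuous. [folklore] -/
theorem continuous_invForm_self : Continuous fun y : Fin (n + 1) → ℝ ↦ invForm n y y := by
  simp only [invForm_apply]
  fun_prop

/-- The moment polynomial is continuous in the vector. [folklore] -/
theorem continuous_momPoly_left (p : Fin 2 → ℝ) : Continuous fun y : Fin (n + 1) → ℝ ↦ momPoly n y p := by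
  simp only [momPoly_apply]
  fun_prop

/-- `Q_g` is continuous on the upper half-plane. [folklore] -/
theorem continuousAt_qSlash {w : ℂ} (hw : 0 < w.im) : ContinuousAt (qSlash n f g x₀) w := by
  have hc : ∀ j, ContinuousAt (fun w ↦ momVecSlash n f g w j) w := fun j ↦
    (hasDerivAt_momVecSlash n f g hw j).continuousAt
  have hv : ContinuousAt (fun w ↦ reVec (momVecSlash n f g w) + x₀) w := by
    refine continuousAt_pi.mpr fun j ↦ ?_
    simp only [Pi.add_apply, reVec_apply]
    exact ((Complex.continuous_re.continuousAt.comp (hc j)).add continuousAt_const)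
  have hq : Continuous fun y : Fin (n + 1) → ℝ ↦ (-1 : ℝ) ^ (n / 2) * invForm n y y :=
    continuous_const.mul (continuous_invForm_self n)
  exact (hq.continuousAt.comp hv :)

/-- **Subharmonicity of `Q_g` at a local maximum of `Q_g + P`** (`P` a real quadratic):
`2 |dFactor|²(2 im gw)ⁿ + 2A + 2B ≤ 0`. [folklore] -/
theorem laplace_qSlash (hn : Even n) {w₀ : ℂ} (hw₀ : 0 < w₀.im) (A B C D E : ℝ)
    (hmax : IsLocalMax (fun w ↦ qSlash n f g x₀ w +
      (A * w.re ^ 2 + B * w.im ^ 2 + C * w.re + D * w.im + E)) w₀) :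
    2 * (Complex.normSq (dFactor n f g w₀) * (2 * (moebius g w₀).im) ^ n) + 2 * A + 2 * B ≤ 0 := by
  have hmax' : IsLocalMax (fun w ↦ (-1 : ℝ) ^ (n / 2) *
      invForm n (reVec (momVecSlash n f g w) + x₀) (reVec (momVecSlash n f g w) + x₀) +
      (A * w.re ^ 2 + B * w.im ^ 2 + C * w.re + D * w.im + E)) w₀ := hmax
  have := laplace_nonpos_of_isLocalMax ((-1 : ℝ) ^ (n / 2)) x₀ (momVecSlash n f g)
    (momVecSlash' n f g) w₀ (eventually_hasDerivAt_momVecSlash n f g hw₀)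
    (differentiableAt_momVecSlash' n f g hw₀) A B C D E hmax'
  rw [mul_assoc (2 : ℝ), laplacian_momVecSlash n f g hn w₀] at this
  exact this

omit [NeZero N] in
/-- The Laplacian term is nonnegative. [folklore] -/
theorem laplace_term_nonneg {w : ℂ} (hw : 0 < w.im) :
    0 ≤ Complex.normSq (dFactor n f g w) * (2 * (moebius g w).im) ^ n :=
  mul_nonneg (Complex.normSq_nonneg _) (pow_nonneg (by linarith [moebius_im_pos g hw]) _)

end Translates

/-! ### §7. Behaviour at the cusps: `Q_g(w)` has a limit as `im w → ∞`, `|re w| ≤ N` -/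

section Cusps

variable {N : ℕ} [NeZero N] (n : ℕ) (f : CuspForm (Gamma0 N) (n + 2)) (g : SL(2, ℤ))
  (x₀ : Fin (n + 1) → ℝ)

/-- The filter "`im w → ∞` with `|re w| ≤ N`". [folklore] -/
def cuspFilter (N : ℕ) : Filter ℂ := comap Complex.im atTop ⊓ 𝓟 {w : ℂ | |w.re| ≤ (N : ℝ)}

omit [NeZero N] in
/-- `im → ∞` along the cusp filter. [folklore] -/
theorem tendsto_im_cuspFilter : Tendsto Complex.im (cuspFilter N) atTop :=
  tendsto_comap.mono_left inf_le_left

omit [NeZero N] in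
/-- Eventually `im w ≥ 1` and `|re w| ≤ N` along the cusp filter. [folklore] -/
theorem eventually_cuspFilter :
    ∀ᶠ w in cuspFilter N, 1 ≤ w.im ∧ |w.re| ≤ (N : ℝ) := by
  have h1 : {w : ℂ | 1 ≤ w.im} ∈ cuspFilter N :=
    Filter.mem_inf_of_left (Filter.preimage_mem_comap (Filter.Ici_mem_atTop (1 : ℝ)))
  have h2 : {w : ℂ | |w.re| ≤ (N : ℝ)} ∈ cuspFilter N :=
    Filter.mem_inf_of_right (mem_principal_self _)
  filter_upwards [h1, h2] with w hw1 hw2 using ⟨hw1, hw2⟩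

/-- **The moments of `f ∣ g` tend to `0` at the cusp**, uniformly for `|re w| ≤ N`
(`exists_norm_powPrimitive_le`). [folklore] -/
theorem tendsto_powPrimitive_slash (j : ℕ) :
    Tendsto (fun w : ℂ ↦ powPrimitive j (⇑f ∣[(n + 2 : ℤ)] g) (ofComplex w)) (cuspFilter N) (𝓝 0) := by
  obtain ⟨C, hC0, hC⟩ := (isCuspFunction_slash f g).exists_norm_powPrimitive_le j
  have hN : (0 : ℝ) < N := by exact_mod_cast Nat.pos_of_ne_zero (NeZero.ne N)
  have ha : 0 < 2 * Real.pi / N := by positivity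
  have hmaj : Tendsto (fun w : ℂ ↦ C * (((1 + N) + 1 * w.im) ^ j *
      Real.exp (-(2 * Real.pi / N) * w.im))) (cuspFilter N) (𝓝 0) := by
    have h1 := (tendsto_affine_pow_mul_exp_neg_atTop (1 + N) 1 j ha).comp (tendsto_im_cuspFilter (N := N))
    have h2 := h1.const_mul C
    rw [mul_zero] at h2
    exact h2
  refine squeeze_zero_norm' ?_ hmaj
  filter_upwards [eventually_cuspFilter (N := N)] with w ⟨hw1, hw2⟩
  have him : 0 < w.im := by linarith
  have hτim : (ofComplex w : ℍ).im = w.im := by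
    rw [← UpperHalfPlane.coe_im, ofComplex_apply_of_im_pos him]
  have hτre : (ofComplex w : ℍ).re = w.re := by
    rw [← UpperHalfPlane.coe_re, ofComplex_apply_of_im_pos him]
  have := hC (ofComplex w) (by rw [hτim]; exact hw1)
  rw [hτim, hτre] at this
  refine this.trans ?_
  have he : 0 ≤ Real.exp (-(2 * Real.pi / N) * w.im) := (Real.exp_pos _).le
  have hb : 0 ≤ 1 + |w.re| + w.im := by have := abs_nonneg w.re; linarith
  have hle : 1 + |w.re| + w.im ≤ (1 + N) + 1 * w.im := by linarith
  rw [← mul_assoc]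
  gcongr

/-- The transformation law seen from the cusp `g∞`, real parts:
`momPoly (re G_g(w)) (g p) = momPoly (re a_{f|g}(w)) p - re c_f(g)(p)` (`periodFn_eq`). [folklore] -/
theorem momPoly_reVec_momVecSlash (w : ℂ) (p : Fin 2 → ℝ) :
    momPoly n (reVec (momVecSlash n f g w)) ((rmat g).mulVec p) =
      momPoly n (reVec (momVec n (⇑f ∣[(n + 2 : ℤ)] g) (ofComplex w))) p -
        (periodFn n f g (fun i ↦ (p i : ℂ))).re := by
  have key := periodFn_eq f g (fun i ↦ (p i : ℂ)) (ofComplex w)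
  rw [icmat_mulVec_ofReal, eichlerKernel_eq_momPoly, eichlerKernel_eq_momPoly] at key
  have hk := congrArg Complex.re key
  rw [Complex.sub_re, momPoly_ofReal_re, momPoly_ofReal_re] at hk
  simp only [momVecSlash]
  linarith

/-- The evaluation map `x ↦ (B(x, e(l)))_{l = 0..n}` (injective by `eq_zero_of_invForm_powVec_eq_zero`). [folklore] -/
def evalMap : (Fin (n + 1) → ℝ) →ₗ[ℝ] (Fin (n + 1) → ℝ) :=
  LinearMap.pi fun l : Fin (n + 1) ↦ (invForm (K := ℝ) n).flip (powVec n (l : ℝ))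

/-- Unfolding `evalMap`. [folklore] -/
@[simp] theorem evalMap_apply (x : Fin (n + 1) → ℝ) (l : Fin (n + 1)) :
    evalMap n x l = invForm n x (powVec n (l : ℝ)) := rfl

/-- `evalMap` is injective. [folklore] -/
theorem evalMap_injective : Injective (evalMap n) := by
  refine (injective_iff_map_eq_zero (evalMap n)).mpr fun x hx ↦ ?_
  refine eq_zero_of_invForm_powVec_eq_zero (w := fun l : Fin (n + 1) ↦ (l : ℝ)) ?_ fun l ↦ ?_
  · intro a b hab
    have h' : ((a : ℕ) : ℝ) = (b : ℕ) := hab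
    exact Fin.ext (by exact_mod_cast h')
  · exact congrFun hx l

/-- **The shifted real moment vector seen from the cusp `g∞` has a limit as `im w → ∞`**
(`|re w| ≤ N`): its evaluations `momPoly (·) (l, 1)` converge by the transformation law and the
decay of the moments of `f ∣ g`, and evaluation at `n + 1` nodes is a linear isomorphism. [folklore] -/
theorem exists_tendsto_rmomVec_slash (hn : Even n) :
    ∃ x : Fin (n + 1) → ℝ,
      Tendsto (fun w ↦ reVec (momVecSlash n f g w) + x₀) (cuspFilter N) (𝓝 x) := by
  set E := LinearEquiv.ofInjectiveEndo (evalMap n) (evalMap_injective n) with hE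
  -- the limits of the evaluations
  set p : Fin (n + 1) → Fin 2 → ℝ := fun l ↦ (rmat g⁻¹).mulVec ![(l : ℝ), 1] with hp
  have hgp : ∀ l, (rmat g).mulVec (p l) = ![(l : ℝ), 1] := by
    intro l
    simp only [hp, Matrix.mulVec_mulVec, ← rmat_mul, mul_inv_cancel, rmat_one, Matrix.one_mulVec]
  set t : Fin (n + 1) → ℝ := fun l ↦ -(periodFn n f g (fun i ↦ (p l i : ℂ))).re +
    momPoly n x₀ ![(l : ℝ), 1] with ht
  have hb : Tendsto (fun w ↦ reVec (momVec n (⇑f ∣[(n + 2 : ℤ)] g) (ofComplex w))) (cuspFilter N)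
      (𝓝 0) := by
    refine tendsto_pi_nhds.mpr fun j ↦ ?_
    have := (Complex.continuous_re.tendsto 0).comp (tendsto_powPrimitive_slash n f g j)
    simpa [momVec, Function.comp_def] using this
  have hev : Tendsto (fun w ↦ evalMap n (reVec (momVecSlash n f g w) + x₀)) (cuspFilter N) (𝓝 t) := by
    refine tendsto_pi_nhds.mpr fun l ↦ ?_
    have e : ∀ w, evalMap n (reVec (momVecSlash n f g w) + x₀) l =
        momPoly n (reVec (momVec n (⇑f ∣[(n + 2 : ℤ)] g) (ofComplex w))) (p l) -
          (periodFn n f g (fun i ↦ (p l i : ℂ))).re + momPoly n x₀ ![(l : ℝ), 1] := by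
      intro w
      rw [evalMap_apply, invForm_powVec_right hn, map_add, Pi.add_apply, ← hgp l,
        momPoly_reVec_momVecSlash, hgp]
    simp only [e, ht]
    have h1 := ((continuous_momPoly_left n (p l)).tendsto 0).comp hb
    have h0 : momPoly n (0 : Fin (n + 1) → ℝ) (p l) = 0 := by rw [map_zero]; rfl
    rw [h0] at h1
    have h2 := (h1.sub_const ((periodFn n f g (fun i ↦ (p l i : ℂ))).re)).add_const
      (momPoly n x₀ ![(l : ℝ), 1])
    rw [zero_sub] at h2
    exact h2
  refine ⟨E.symm t, ?_⟩
  have hcont : Continuous (E.symm : (Fin (n + 1) → ℝ) → (Fin (n + 1) → ℝ)) :=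
    LinearMap.continuous_of_finiteDimensional (E.symm : (Fin (n + 1) → ℝ) →ₗ[ℝ] (Fin (n + 1) → ℝ))
  have := (hcont.tendsto t).comp hev
  refine this.congr fun w ↦ ?_
  simp only [Function.comp_apply]
  exact E.symm_apply_apply _

/-- **`Q_g` has a limit at the cusp**: `Q_g(w) → L_g` as `im w → ∞`, `|re w| ≤ N`. [folklore] -/
theorem exists_tendsto_qSlash (hn : Even n) :
    ∃ L : ℝ, Tendsto (qSlash n f g x₀) (cuspFilter N) (𝓝 L) := by
  obtain ⟨x, hx⟩ := exists_tendsto_rmomVec_slash n f g x₀ hn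
  refine ⟨(-1) ^ (n / 2) * invForm n x x, ?_⟩
  have hq : Continuous fun y : Fin (n + 1) → ℝ ↦ (-1 : ℝ) ^ (n / 2) * invForm n y y :=
    continuous_const.mul (continuous_invForm_self n)
  exact (hq.tendsto x).comp hx

/-- The cusp limit in `ε`–`Y` form. [folklore] -/
theorem exists_cusp_limit (hn : Even n) :
    ∃ L : ℝ, ∀ ε > 0, ∃ Y : ℝ, 1 ≤ Y ∧
      ∀ w : ℂ, |w.re| ≤ (N : ℝ) → Y ≤ w.im → |qSlash n f g x₀ w - L| < ε := by
  obtain ⟨L, hL⟩ := exists_tendsto_qSlash n f g x₀ hn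
  refine ⟨L, fun ε hε ↦ ?_⟩
  have h := (Metric.tendsto_nhds.mp hL) ε hε
  rw [cuspFilter, Filter.eventually_inf_principal, Filter.eventually_comap, Filter.eventually_atTop]
    at h
  obtain ⟨Y₀, hY₀⟩ := h
  refine ⟨max Y₀ 1, le_max_right _ _, fun w hw hY ↦ ?_⟩
  have := hY₀ w.im ((le_max_left _ _).trans hY) w rfl hw
  rwa [Real.dist_eq] at this

end Cusps

/-! ### §8. Invariance bookkeeping: periodicity of `Q_g`, reduction of `re w`, covering by cusps -/

section Covering

variable {N : ℕ} [NeZero N] (n : ℕ) (hn : Even n) (f : CuspForm (Gamma0 N) (n + 2))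
  (x₀ : Fin (n + 1) → ℝ) (hre : IsReCoboundary n f x₀)
include hn hre

/-- **`Q_g` is `N`-periodic** (`g Tᵏᴺ g⁻¹ ∈ Γ₀(N)` and `Q` is `Γ₀(N)`-invariant). [folklore] -/
theorem qSlash_add_int_mul (g : SL(2, ℤ)) {w : ℂ} (hw : 0 < w.im) (k : ℤ) :
    qSlash n f g x₀ (w + (k : ℂ) * N) = qSlash n f g x₀ w := by
  have hmem : g * ModularGroup.T ^ ((k : ℤ) * N) * g⁻¹ ∈ Gamma0 N := by
    have h1 := conj_T_zpow_mem_Gamma0 (N := N) g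
    have e : g * ModularGroup.T ^ ((k : ℤ) * N) * g⁻¹ = (g * ModularGroup.T ^ (N : ℤ) * g⁻¹) ^ k := by
      rw [conj_zpow, mul_comm (k : ℤ), zpow_mul]
    rw [e]
    exact Subgroup.zpow_mem _ h1 k
  have hw' : 0 < (w + (k : ℂ) * N).im := by simpa using hw
  have hT : ofComplex (w + (k : ℂ) * N) = (ModularGroup.T ^ ((k : ℤ) * N)) • ofComplex w := by
    ext1
    rw [ModularGroup.coe_T_zpow_smul_eq, ofComplex_apply_of_im_pos hw, ofComplex_apply_of_im_pos hw']
    push_cast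
    ring
  unfold qSlash
  rw [hT, ← mul_smul,
    show g * ModularGroup.T ^ ((k : ℤ) * N) = (g * ModularGroup.T ^ ((k : ℤ) * N) * g⁻¹) * g by group,
    mul_smul]
  exact qInv_smul n hn f x₀ hre ⟨_, hmem⟩ (g • ofComplex w)

omit hn hre in
/-- Every `w` has a translate by `ℤN` with `|re| ≤ N`. [folklore] -/
theorem exists_int_abs_re_le (w : ℂ) :
    ∃ k : ℤ, |(w + (k : ℂ) * N).re| ≤ (N : ℝ) ∧ (w + (k : ℂ) * N).im = w.im := by
  have hN : (0 : ℝ) < N := by exact_mod_cast Nat.pos_of_ne_zero (NeZero.ne N)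
  have e : ∀ k : ℤ, (w + (k : ℂ) * N).re = w.re + (k : ℝ) * N := fun k ↦ by
    have : ((k : ℂ) * (N : ℂ)) = (((k : ℝ) * N : ℝ) : ℂ) := by push_cast; ring
    rw [Complex.add_re, this, Complex.ofReal_re]
  have e' : ∀ k : ℤ, (w + (k : ℂ) * N).im = w.im := fun k ↦ by
    have : ((k : ℂ) * (N : ℂ)) = (((k : ℝ) * N : ℝ) : ℂ) := by push_cast; ring
    rw [Complex.add_im, this, Complex.ofReal_im, add_zero]
  refine ⟨-⌊w.re / N⌋, ?_, e' _⟩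
  have hre' : (w + ((-⌊w.re / N⌋ : ℤ) : ℂ) * N).re = N * Int.fract (w.re / N) := by
    rw [e, Int.fract, Int.cast_neg]
    field_simp
    ring
  rw [hre']
  have h0 := Int.fract_nonneg (w.re / N)
  have h1 := (Int.fract_lt_one (w.re / N)).le
  rw [abs_of_nonneg (by positivity)]
  nlinarith

omit hn hre in
/-- **Maxima over rectangles**: `Q_g` attains its maximum over `{|re w| ≤ N, a ≤ im w ≤ b}`
(`0 < a ≤ b`). [folklore] -/
theorem exists_isMaxOn_rect (g : SL(2, ℤ)) {a b : ℝ} (ha : 0 < a) (hab : a ≤ b) :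
    ∃ w₀ : ℂ, (|w₀.re| ≤ (N : ℝ) ∧ w₀.im ∈ Icc a b) ∧
      ∀ w : ℂ, |w.re| ≤ (N : ℝ) → w.im ∈ Icc a b → qSlash n f g x₀ w ≤ qSlash n f g x₀ w₀ := by
  set R : Set ℂ := {w : ℂ | |w.re| ≤ (N : ℝ) ∧ w.im ∈ Icc a b} with hR
  have hclosed : IsClosed R :=
    (isClosed_le (continuous_abs.comp Complex.continuous_re) continuous_const).inter
      (isClosed_Icc.preimage Complex.continuous_im)
  have hbdd : Bornology.IsBounded R := by
    rw [isBounded_iff_forall_norm_le]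
    refine ⟨N + b, fun w ⟨h1, h2⟩ ↦ (Complex.norm_le_abs_re_add_abs_im w).trans ?_⟩
    have : |w.im| ≤ b := by rw [abs_of_nonneg (by linarith [h2.1])]; exact h2.2
    linarith
  have hK : IsCompact R := Metric.isCompact_of_isClosed_isBounded hclosed hbdd
  have hne : R.Nonempty := ⟨(a : ℂ) * Complex.I, by
    refine ⟨?_, ?_⟩
    · simp
    · simp [hab]⟩
  have hcont : ContinuousOn (qSlash n f g x₀) R := fun w ⟨_, h2⟩ ↦
    (continuousAt_qSlash n f g x₀ (by linarith [h2.1])).continuousWithinAt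
  obtain ⟨w₀, hw₀, hmax⟩ := hK.exists_isMaxOn hne hcont
  exact ⟨w₀, hw₀, fun w h1 h2 ↦ hmax ⟨h1, h2⟩⟩

/-- **Covering by the cusps**: every value `Q(τ)` is a value `Q_{g_i}(w)` with `|re w| ≤ N`,
`im w > 1/2`, where `g_i = (out i)⁻¹` runs over representatives of `SL(2, ℤ)/Γ₀(N)` (move `τ`
into the standard fundamental domain, Mathlib `ModularGroup.exists_smul_mem_fd`). [folklore] -/
theorem exists_rep_eq (τ : ℍ) :
    ∃ (i : SL(2, ℤ) ⧸ Gamma0 N) (w : ℂ), |w.re| ≤ (N : ℝ) ∧ 1 / 2 < w.im ∧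
      qInv n f x₀ τ = qSlash n f (Quotient.out i)⁻¹ x₀ w := by
  have hN : (1 : ℝ) ≤ N := by exact_mod_cast Nat.one_le_iff_ne_zero.mpr (NeZero.ne N)
  obtain ⟨σ₀, hσ₀⟩ := ModularGroup.exists_smul_mem_fd τ
  obtain ⟨γ, hγ⟩ := QuotientGroup.mk_out_eq_mul (Gamma0 N) σ₀
  refine ⟨QuotientGroup.mk σ₀, ((σ₀ • τ : ℍ) : ℂ), ?_, ?_, ?_⟩
  · have h := hσ₀.2
    rw [UpperHalfPlane.coe_re]
    linarith [abs_nonneg (σ₀ • τ).re]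
  · have h3 := ModularGroup.three_le_four_mul_im_sq_of_mem_fd hσ₀
    rw [UpperHalfPlane.coe_im]
    nlinarith [(σ₀ • τ).im_pos]
  · simp only [qSlash, ofComplex_apply, hγ, mul_inv_rev, mul_smul, inv_smul_smul]
    rw [← Subgroup.coe_inv, qInv_smul n hn f x₀ hre]

end Covering

/-! ### §9. The maximum principle: interior maximum, and maximum at a cusp -/

section MaxPrinciple

variable {N : ℕ} [NeZero N] (n : ℕ) (hn : Even n) (f : CuspForm (Gamma0 N) (n + 2))
  (x₀ : Fin (n + 1) → ℝ) (hre : IsReCoboundary n f x₀)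
include hn

/-- **Interior maximum forces `f = 0`.** If `Q` attains its supremum at a point `τ₀ ∈ ℍ`, then
for every small `r` there is a zero of `f` on the circle `|w - τ₀| = r`: maximise
`Q + ε|w - τ₀|²` over the closed disc — an interior maximum would contradict subharmonicity
(`ΔQ ≥ 0`, `Δ(ε|w - τ₀|²) = 4ε > 0`), so the maximum is on the circle and `≥ Q(τ₀)`; letting
`ε → 0`, `Q = Q(τ₀)` somewhere on the circle, a new global maximum, where `ΔQ ≤ 0` forces
`f = 0`. These zeros accumulate at `τ₀`, so `f ≡ 0` by the identity theorem. [folklore] -/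
theorem eq_zero_of_isMax_qInv (τ₀ : ℍ) (hmax : ∀ τ : ℍ, qInv n f x₀ τ ≤ qInv n f x₀ τ₀) :
    f = 0 := by
  set u : ℂ → ℝ := qSlash n f 1 x₀ with hu
  set w₀ : ℂ := (τ₀ : ℂ) with hw₀def
  have hw₀ : 0 < w₀.im := τ₀.im_pos
  have huw : ∀ w : ℂ, u w = qInv n f x₀ (ofComplex w) := fun w ↦ by simp [hu, qSlash]
  have hu₀ : u w₀ = qInv n f x₀ τ₀ := by rw [huw, hw₀def, ofComplex_apply]
  have hu_le : ∀ w : ℂ, u w ≤ u w₀ := fun w ↦ by rw [huw, hu₀]; exact hmax _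
  have hd1 : ∀ w : ℂ, dFactor n f 1 w = -f (ofComplex w) := fun w ↦ by simp [dFactor]
  -- a zero of `f` on every small circle about `w₀`
  have hcirc : ∀ r : ℝ, 0 < r → r < w₀.im → ∃ p : ℂ, ‖p - w₀‖ = r ∧ f (ofComplex p) = 0 := by
    intro r hr hrw
    have hball : ∀ p ∈ Metric.closedBall w₀ r, 0 < p.im := by
      intro p hp
      have h1 : |(p - w₀).im| ≤ ‖p - w₀‖ := Complex.abs_im_le_norm (p - w₀)
      rw [Metric.mem_closedBall, dist_eq_norm] at hp
      rw [Complex.sub_im] at h1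
      have := abs_le.mp (h1.trans hp)
      linarith
    -- for each `ε > 0` a point on the circle with `u ≥ u w₀ - ε r²`
    have hε : ∀ ε : ℝ, 0 < ε → ∃ p : ℂ, ‖p - w₀‖ = r ∧ u w₀ - ε * r ^ 2 ≤ u p := by
      intro ε hε
      set v : ℂ → ℝ := fun w ↦ u w + ε * ‖w - w₀‖ ^ 2 with hv
      have hK : IsCompact (Metric.closedBall w₀ r) := isCompact_closedBall _ _
      have hne : (Metric.closedBall w₀ r).Nonempty := ⟨w₀, Metric.mem_closedBall_self hr.le⟩
      have hcont : ContinuousOn v (Metric.closedBall w₀ r) := by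
        intro p hp
        refine ContinuousAt.continuousWithinAt ?_
        exact (continuousAt_qSlash n f 1 x₀ (hball p hp)).add
          ((continuous_const.mul ((continuous_id.sub continuous_const).norm.pow 2)).continuousAt)
      obtain ⟨p, hpK, hpmax⟩ := hK.exists_isMaxOn hne hcont
      have hpK' := hpK
      rw [Metric.mem_closedBall, dist_eq_norm] at hpK'
      have hpr : ‖p - w₀‖ = r := by
        rcases hpK'.lt_or_eq with hlt | heq
        · exfalso
          have hnhds : Metric.closedBall w₀ r ∈ 𝓝 p :=
            mem_of_superset (Metric.isOpen_ball.mem_nhds (by rwa [Metric.mem_ball, dist_eq_norm]))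
              Metric.ball_subset_closedBall
          have hloc : IsLocalMax v p := hpmax.isLocalMax hnhds
          have hv' : v = fun w ↦ qSlash n f 1 x₀ w + (ε * w.re ^ 2 + ε * w.im ^ 2 +
              (-2 * ε * w₀.re) * w.re + (-2 * ε * w₀.im) * w.im + ε * (w₀.re ^ 2 + w₀.im ^ 2)) := by
            funext w
            simp only [hv, hu, Complex.sq_norm, Complex.normSq_apply, Complex.sub_re,
              Complex.sub_im]
            ring
          rw [hv'] at hloc
          have h1 := laplace_qSlash n f 1 x₀ hn (hball p hpK) _ _ _ _ _ hloc
          have h2 := laplace_term_nonneg n f 1 (hball p hpK)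
          linarith
        · exact heq
      refine ⟨p, hpr, ?_⟩
      have h1 : v w₀ ≤ v p := hpmax (Metric.mem_closedBall_self hr.le)
      simp only [hv, sub_self, norm_zero, hpr] at h1
      linarith
    -- `u` attains `u w₀` on the circle
    have hS : IsCompact (Metric.sphere w₀ r) := isCompact_sphere _ _
    have hSne : (Metric.sphere w₀ r).Nonempty := NormedSpace.sphere_nonempty.mpr hr.le
    have hsub : Metric.sphere w₀ r ⊆ Metric.closedBall w₀ r := Metric.sphere_subset_closedBall
    have hcontu : ContinuousOn u (Metric.sphere w₀ r) := fun p hp ↦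
      (continuousAt_qSlash n f 1 x₀ (hball p (hsub hp))).continuousWithinAt
    obtain ⟨p, hpS, hpmax⟩ := hS.exists_isMaxOn hSne hcontu
    have hp0 : 0 < p.im := hball p (hsub hpS)
    have hup : u p = u w₀ := by
      refine le_antisymm (hu_le p) ?_
      by_contra hlt
      push Not at hlt
      obtain ⟨q, hq, hq'⟩ := hε ((u w₀ - u p) / (2 * r ^ 2)) (by positivity)
      have hq'' : u q ≤ u p := hpmax (show q ∈ Metric.sphere w₀ r by simpa [dist_eq_norm] using hq)
      have : (u w₀ - u p) / (2 * r ^ 2) * r ^ 2 = (u w₀ - u p) / 2 := by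
        field_simp
      linarith
    -- `p` is a global maximum of `u` in the upper half-plane: `f(p) = 0`
    have hloc : IsLocalMax (fun w ↦ qSlash n f 1 x₀ w +
        (0 * w.re ^ 2 + 0 * w.im ^ 2 + 0 * w.re + 0 * w.im + 0)) p := by
      have : ∀ᶠ w in 𝓝 p, u w ≤ u p := Eventually.of_forall fun w ↦ hup ▸ hu_le w
      simpa [IsLocalMax, IsMaxFilter, hu] using this
    have h1 := laplace_qSlash n f 1 x₀ hn hp0 0 0 0 0 0 hloc
    have h2 := laplace_term_nonneg n f 1 hp0
    have h3 : Complex.normSq (dFactor n f 1 p) * (2 * (moebius 1 p).im) ^ n = 0 := by linarith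
    have h4 : (0 : ℝ) < (2 * (moebius 1 p).im) ^ n := pow_pos (by simpa using hp0) _
    have h5 : Complex.normSq (dFactor n f 1 p) = 0 := by
      rcases mul_eq_zero.mp h3 with h | h
      · exact h
      · exact absurd h h4.ne'
    refine ⟨p, by simpa [dist_eq_norm] using hpS, ?_⟩
    have := Complex.normSq_eq_zero.mp h5
    rwa [hd1, neg_eq_zero] at this
  -- the zeros accumulate at `w₀`: identity theorem
  have hd : DifferentiableOn ℂ (⇑f ∘ ofComplex) {z : ℂ | 0 < z.im} :=
    UpperHalfPlane.mdifferentiable_iff.mp (isCuspFunction_one f).mdifferentiable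
  have han : AnalyticOnNhd ℂ (⇑f ∘ ofComplex) {z : ℂ | 0 < z.im} :=
    hd.analyticOnNhd isOpen_upperHalfPlaneSet
  have hfr : ∃ᶠ z in 𝓝[≠] w₀, (⇑f ∘ ofComplex) z = 0 := by
    rw [Filter.frequently_iff]
    intro U hU
    obtain ⟨δ, hδ, hδU⟩ := Metric.mem_nhdsWithin_iff.mp hU
    obtain ⟨p, hp, hfp⟩ := hcirc (min (δ / 2) (w₀.im / 2)) (by positivity)
      ((min_le_right _ _).trans_lt (by linarith))
    refine ⟨p, hδU ⟨?_, ?_⟩, hfp⟩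
    · rw [Metric.mem_ball, dist_eq_norm, hp]
      exact (min_le_left _ _).trans_lt (by linarith)
    · intro (hpw : p = w₀)
      rw [hpw, sub_self, norm_zero] at hp
      have : (0 : ℝ) < min (δ / 2) (w₀.im / 2) := by positivity
      linarith
  have heq := han.eqOn_zero_of_preconnected_of_frequently_eq_zero
    (convex_halfSpace_im_gt 0).isPreconnected hw₀ hfr
  ext τ
  have := heq τ.im_pos
  simpa [ofComplex_apply] using this

include hre

/-- **No maximum at a cusp.** If `Q < S` everywhere but `Q_g(w) → S` at the cusp `g∞`, compare
on strips: with `m₁ = max_{im w = 1} Q_g < S`, the `N`-periodic function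
`v = Q_g - (m₁ + (S - m₁)(im w - 1)/(Y₂ - 1)) + ε(im w - 1)(im w - Y₂)` is `≤ 0` on `im w = 1`
and on `im w = Y₂`, hence `≤ 0` on the strip (an interior maximum contradicts
`ΔQ_g + 2ε > 0`); letting `ε → 0` and `Y₂ → ∞` gives `Q_g ≤ m₁ < S` high in the cusp — a
contradiction. [folklore] -/
theorem false_of_tendsto_cusp (g : SL(2, ℤ)) (S : ℝ) (hlt : ∀ τ : ℍ, qInv n f x₀ τ < S)
    (hlim : ∀ ε > 0, ∃ Y : ℝ, 1 ≤ Y ∧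
      ∀ w : ℂ, |w.re| ≤ (N : ℝ) → Y ≤ w.im → |qSlash n f g x₀ w - S| < ε) : False := by
  set u : ℂ → ℝ := qSlash n f g x₀ with hu
  have hu_lt : ∀ w : ℂ, u w < S := fun w ↦ hlt _
  have hper : ∀ w : ℂ, 0 < w.im → ∀ k : ℤ, u (w + (k : ℂ) * N) = u w := fun w hw k ↦
    qSlash_add_int_mul n hn f x₀ hre g hw k
  -- `m₁ = max u` on `im w = 1`
  obtain ⟨w₁, ⟨hw₁re, hw₁im⟩, hw₁⟩ := exists_isMaxOn_rect n f x₀ g (a := 1) (b := 1)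
    one_pos le_rfl
  set m₁ := u w₁ with hm₁
  have hm₁S : m₁ < S := hu_lt w₁
  have hline₁ : ∀ w : ℂ, w.im = 1 → u w ≤ m₁ := by
    intro w hw
    obtain ⟨k, hk, hkim⟩ := exists_int_abs_re_le (N := N) w
    rw [← hper w (by rw [hw]; exact one_pos) k]
    exact hw₁ _ hk (by rw [hkim, hw]; exact ⟨le_rfl, le_rfl⟩)
  -- a point high in the cusp with `u > (S + m₁)/2`
  obtain ⟨Y, hY1, hY⟩ := hlim ((S - m₁) / 2) (by linarith)
  set Y' : ℝ := Y + 1 with hY'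
  set wstar : ℂ := (Y' : ℂ) * Complex.I with hwstar
  have hwre : wstar.re = 0 := by simp [hwstar]
  have hwim : wstar.im = Y' := by simp [hwstar]
  have hustar : (S + m₁) / 2 < u wstar := by
    have := hY wstar (by rw [hwre, abs_zero]; positivity) (by rw [hwim, hY']; linarith)
    rw [abs_lt] at this
    linarith
  -- the comparison on strips `1 ≤ im w ≤ Y₂`
  have hstrip : ∀ Y₂ : ℝ, Y' < Y₂ → ∀ ε > 0,
      u wstar ≤ m₁ + (S - m₁) * (Y' - 1) / (Y₂ - 1) + ε * (Y' - 1) * (Y₂ - Y') := by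
    intro Y₂ hY₂ ε hε
    have hY₂1 : (0 : ℝ) < Y₂ - 1 := by linarith
    set D : ℝ := -(S - m₁) / (Y₂ - 1) - ε * (1 + Y₂) with hD
    set E : ℝ := -m₁ + (S - m₁) / (Y₂ - 1) + ε * Y₂ with hE
    set v : ℂ → ℝ := fun w ↦ u w + (0 * w.re ^ 2 + ε * w.im ^ 2 + 0 * w.re + D * w.im + E)
      with hv
    have hv_eq : ∀ w : ℂ, v w = u w - (m₁ + (S - m₁) * (w.im - 1) / (Y₂ - 1)) +
        ε * (w.im - 1) * (w.im - Y₂) := by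
      intro w
      simp only [hv, hD, hE]
      field_simp
      ring
    -- it suffices that `v wstar ≤ 0`
    suffices hvs : v wstar ≤ 0 by
      rw [hv_eq, hwim] at hvs
      nlinarith
    by_contra hpos
    push Not at hpos
    -- maximum of `v` on the rectangle
    set R : Set ℂ := {w : ℂ | |w.re| ≤ (N : ℝ) ∧ w.im ∈ Icc 1 Y₂} with hR
    have hclosed : IsClosed R :=
      (isClosed_le (continuous_abs.comp Complex.continuous_re) continuous_const).inter
        (isClosed_Icc.preimage Complex.continuous_im)
    have hbdd : Bornology.IsBounded R := by
      rw [isBounded_iff_forall_norm_le]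
      refine ⟨N + Y₂, fun w ⟨h1, h2⟩ ↦ (Complex.norm_le_abs_re_add_abs_im w).trans ?_⟩
      have : |w.im| ≤ Y₂ := by rw [abs_of_nonneg (by linarith [h2.1])]; exact h2.2
      linarith
    have hK : IsCompact R := Metric.isCompact_of_isClosed_isBounded hclosed hbdd
    have hwR : wstar ∈ R := ⟨by rw [hwre, abs_zero]; positivity, by
      rw [hwim]; exact ⟨by rw [hY']; linarith, hY₂.le⟩⟩
    have hvper : ∀ w : ℂ, 0 < w.im → ∀ k : ℤ, v (w + (k : ℂ) * N) = v w := by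
      intro w hw k
      obtain ⟨-, hkim⟩ := (⟨trivial, (exists_int_abs_re_le (N := N) w).choose_spec.2⟩ :
        True ∧ _)
      have him : (w + (k : ℂ) * N).im = w.im := by
        have : ((k : ℂ) * (N : ℂ)) = (((k : ℝ) * N : ℝ) : ℂ) := by push_cast; ring
        rw [Complex.add_im, this, Complex.ofReal_im, add_zero]
      rw [hv_eq, hv_eq, hper w hw k, him]
    have hcontv : ContinuousOn v R := by
      intro w ⟨_, h2⟩
      refine ContinuousAt.continuousWithinAt ?_
      refine (continuousAt_qSlash n f g x₀ (by linarith [h2.1])).add ?_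
      fun_prop
    obtain ⟨q, hqR, hqmax⟩ := hK.exists_isMaxOn ⟨wstar, hwR⟩ hcontv
    have hvq : 0 < v q := hpos.trans_le (hqmax hwR)
    -- `q` is not on the boundary lines
    have hq1 : q.im ≠ 1 := by
      intro h
      have := hline₁ q h
      rw [hv_eq, h] at hvq
      simp at hvq
      linarith
    have hq2 : q.im ≠ Y₂ := by
      intro h
      have := hu_lt q
      rw [hv_eq, h] at hvq
      field_simp at hvq
      nlinarith
    have hq1' : 1 < q.im := lt_of_le_of_ne hqR.2.1 (Ne.symm hq1)
    have hq2' : q.im < Y₂ := lt_of_le_of_ne hqR.2.2 hq2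
    -- hence a local maximum of `v`
    have hloc : IsLocalMax v q := by
      have hU : {w : ℂ | 1 < w.im ∧ w.im < Y₂} ∈ 𝓝 q :=
        (IsOpen.inter (isOpen_lt continuous_const Complex.continuous_im)
          (isOpen_lt Complex.continuous_im continuous_const)).mem_nhds ⟨hq1', hq2'⟩
      filter_upwards [hU] with w ⟨h1, h2⟩
      obtain ⟨k, hk, hkim⟩ := exists_int_abs_re_le (N := N) w
      rw [← hvper w (by linarith) k]
      exact hqmax ⟨hk, by rw [hkim]; exact ⟨h1.le, h2.le⟩⟩
    have h1 := laplace_qSlash n f g x₀ hn (by linarith : 0 < q.im) 0 ε 0 D E hloc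
    have h2 := laplace_term_nonneg n f g (by linarith : 0 < q.im)
    linarith
  -- let `ε → 0`: `u wstar ≤ m₁ + (S - m₁)(Y' - 1)/(Y₂ - 1)`
  have hstrip' : ∀ Y₂ : ℝ, Y' < Y₂ → u wstar ≤ m₁ + (S - m₁) * (Y' - 1) / (Y₂ - 1) := by
    intro Y₂ hY₂
    have hc : 0 < (Y' - 1) * (Y₂ - Y') := mul_pos (by rw [hY']; linarith) (by linarith)
    by_contra hlt'
    push Not at hlt'
    set d := u wstar - (m₁ + (S - m₁) * (Y' - 1) / (Y₂ - 1)) with hd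
    have hdpos : 0 < d := by linarith
    have := hstrip Y₂ hY₂ (d / (2 * ((Y' - 1) * (Y₂ - Y')))) (by positivity)
    have hne1 : Y' - 1 ≠ 0 := by rw [hY']; linarith
    have hne2 : Y₂ - Y' ≠ 0 := (sub_pos.mpr hY₂).ne'
    have e : d / (2 * ((Y' - 1) * (Y₂ - Y'))) * (Y' - 1) * (Y₂ - Y') = d / 2 := by
      field_simp
    linarith
  -- let `Y₂ → ∞`: `u wstar ≤ m₁`
  have hfin : u wstar ≤ m₁ := by
    by_contra hlt'
    push Not at hlt'
    set d := u wstar - m₁ with hd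
    have hdpos : 0 < d := by linarith
    have hY'1 : 0 < Y' - 1 := by rw [hY']; linarith
    have hSm : 0 < S - m₁ := by linarith
    set Y₂ : ℝ := Y' + 1 + 2 * (S - m₁) * (Y' - 1) / d with hY₂
    have hY₂' : Y' < Y₂ := by
      have : 0 < 2 * (S - m₁) * (Y' - 1) / d := by positivity
      rw [hY₂]; linarith
    have h1 := hstrip' Y₂ hY₂'
    have h2 : (S - m₁) * (Y' - 1) / (Y₂ - 1) ≤ d / 2 := by
      rw [div_le_iff₀ (by linarith)]
      have : 2 * (S - m₁) * (Y' - 1) / d * d = 2 * (S - m₁) * (Y' - 1) := by field_simp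
      nlinarith
    linarith
  linarith

end MaxPrinciple

/-! ### §10. The theorems -/

section Main

variable {N : ℕ} [NeZero N] (n : ℕ)

/-- **Real injectivity of the Eichler–Shimura map, cohomological form (even weight).** Let
`f ∈ S_{n+2}(Γ₀(N))`, `n` even, and suppose the real parts of its periods are a real coboundary:
for some `x₀ ∈ ℝⁿ⁺¹`, `re c_f(γ)(p) = momPoly x₀ (γp) - momPoly x₀ p` for all `γ ∈ Γ₀(N)`,
`p ∈ ℝ²`. Then `f = 0`. (The class of `re c_f` in `H¹(Γ₀(N), Symⁿℝ²)` determines `f`: the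
injectivity half of the *real* Eichler–Shimura isomorphism, Shimura 1971, Thm. 8.4 with (8.2.17) —
there proved with the Petersson product via Stokes' theorem; here by the maximum principle for the
`Γ₀(N)`-invariant subharmonic function `Q = (-1)^{n/2} B(re a + x₀, re a + x₀)`.) [cite: Shimura1971, Thm. 8.4 and §8.2 (8.2.17)–(8.2.19)] -/
theorem eq_zero_of_isReCoboundary (hn : Even n) (f : CuspForm (Gamma0 N) (n + 2))
    (x₀ : Fin (n + 1) → ℝ) (hre : IsReCoboundary n f x₀) : f = 0 := by
  classical
  set ι := SL(2, ℤ) ⧸ Gamma0 N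
  haveI : Nonempty ι := ⟨((1 : SL(2, ℤ)) : SL(2, ℤ) ⧸ Gamma0 N)⟩
  set rep : ι → SL(2, ℤ) := fun i ↦ (Quotient.out i)⁻¹ with hrep
  -- cusp limits
  choose L hL using fun i ↦ exists_cusp_limit n f (rep i) x₀ hn
  have hcov : ∀ τ : ℍ, ∃ (i : ι) (w : ℂ), |w.re| ≤ (N : ℝ) ∧ 1 / 2 < w.im ∧
      qInv n f x₀ τ = qSlash n f (rep i) x₀ w := exists_rep_eq n hn f x₀ hre
  have hval : ∀ (i : ι) (w : ℂ), qSlash n f (rep i) x₀ w = qInv n f x₀ (rep i • ofComplex w) :=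
    fun _ _ ↦ rfl
  -- boundedness
  have hbd : ∀ i : ι, ∃ B : ℝ, ∀ w : ℂ, |w.re| ≤ (N : ℝ) → 1 / 2 < w.im → qSlash n f (rep i) x₀ w ≤ B := by
    intro i
    obtain ⟨Y, hY1, hY⟩ := hL i 1 one_pos
    obtain ⟨w₀, -, hw₀⟩ := exists_isMaxOn_rect n f x₀ (rep i) (a := 1 / 2) (b := Y)
      (by norm_num) (by linarith)
    refine ⟨max (L i + 1) (qSlash n f (rep i) x₀ w₀), fun w hw1 hw2 ↦ ?_⟩
    rcases le_or_gt Y w.im with h | h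
    · have := hY w hw1 h
      rw [abs_lt] at this
      exact le_trans (by linarith) (le_max_left _ _)
    · exact (hw₀ w hw1 ⟨hw2.le, h.le⟩).trans (le_max_right _ _)
  choose B hB using hbd
  obtain ⟨i₁, hi₁⟩ := Finite.exists_max B
  have hbdd : BddAbove (Set.range (qInv n f x₀)) := by
    refine ⟨B i₁, ?_⟩
    rintro _ ⟨τ, rfl⟩
    obtain ⟨i, w, h1, h2, h3⟩ := hcov τ
    rw [h3]
    exact (hB i w h1 h2).trans (hi₁ i)
  set S := sSup (Set.range (qInv n f x₀)) with hS
  have hleS : ∀ τ, qInv n f x₀ τ ≤ S := fun τ ↦ le_csSup hbdd ⟨τ, rfl⟩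
  have hLle : ∀ i, L i ≤ S := by
    intro i
    by_contra hlt
    push Not at hlt
    obtain ⟨Y, hY1, hY⟩ := hL i (L i - S) (by linarith)
    have := hY ((Y : ℂ) * Complex.I) (by simp) (by simp)
    rw [abs_lt, hval] at this
    have := hleS (rep i • ofComplex ((Y : ℂ) * Complex.I))
    linarith
  by_cases hA : ∃ τ₀, qInv n f x₀ τ₀ = S
  · obtain ⟨τ₀, h₀⟩ := hA
    exact eq_zero_of_isMax_qInv n hn f x₀ τ₀ (fun τ ↦ h₀ ▸ hleS τ)
  · push Not at hA
    have hlt : ∀ τ, qInv n f x₀ τ < S := fun τ ↦ lt_of_le_of_ne (hleS τ) (hA τ)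
    exfalso
    have hex : ∃ i, L i = S := by
      by_contra hne
      push Not at hne
      have hLlt : ∀ i, L i < S := fun i ↦ lt_of_le_of_ne (hLle i) (hne i)
      have key : ∀ i : ι, ∃ B' < S, ∀ w : ℂ, |w.re| ≤ (N : ℝ) → 1 / 2 < w.im →
          qSlash n f (rep i) x₀ w ≤ B' := by
        intro i
        obtain ⟨Y, hY1, hY⟩ := hL i ((S - L i) / 2) (by linarith [hLlt i])
        obtain ⟨w₀, -, hw₀⟩ := exists_isMaxOn_rect n f x₀ (rep i) (a := 1 / 2) (b := Y)
          (by norm_num) (by linarith)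
        refine ⟨max ((S + L i) / 2) (qSlash n f (rep i) x₀ w₀), max_lt (by linarith [hLlt i])
          (by rw [hval]; exact hlt _), fun w hw1 hw2 ↦ ?_⟩
        rcases le_or_gt Y w.im with h | h
        · have := hY w hw1 h
          rw [abs_lt] at this
          exact le_trans (by linarith) (le_max_left _ _)
        · exact (hw₀ w hw1 ⟨hw2.le, h.le⟩).trans (le_max_right _ _)
      choose B' hB'lt hB' using key
      obtain ⟨i₀, hi₀⟩ := Finite.exists_max B'
      have hall : ∀ τ, qInv n f x₀ τ ≤ B' i₀ := fun τ ↦ by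
        obtain ⟨i, w, h1, h2, h3⟩ := hcov τ
        rw [h3]
        exact (hB' i w h1 h2).trans (hi₀ i)
      have : S ≤ B' i₀ := csSup_le (Set.range_nonempty _) (by rintro _ ⟨τ, rfl⟩; exact hall τ)
      linarith [hB'lt i₀]
    obtain ⟨i, hi⟩ := hex
    exact false_of_tendsto_cusp n hn f x₀ hre (rep i) S hlt (hi ▸ hL i)

/-- **Real injectivity, integer-point form.** If the real parts of the periods at integer points are
an integral/real coboundary — `re c_f(γ)(q) = momPoly x₀ (γq) - momPoly x₀ q` for all
`γ ∈ Γ₀(N)`, `q ∈ ℤ²` — then `f = 0` (even `n`). [cite: Shimura1971, Thm. 8.4] -/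
theorem eq_zero_of_re_periodFn_int_coboundary (hn : Even n) (f : CuspForm (Gamma0 N) (n + 2))
    (x₀ : Fin (n + 1) → ℝ)
    (h : ∀ (γ : Gamma0 N) (q : Fin 2 → ℤ), (periodFn n f γ (fun i ↦ (q i : ℂ))).re =
      momPoly n x₀ ((rmat γ).mulVec (fun i ↦ (q i : ℝ))) - momPoly n x₀ (fun i ↦ (q i : ℝ))) :
    f = 0 :=
  eq_zero_of_isReCoboundary n hn f x₀ (isReCoboundary_of_int f x₀ h)

/-- **Real separation by the period lattice** (even weight `n + 2`): if `re φ(f) = 0` for every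
period functional `φ ∈ periodLatticeK n` (equivalently `re c_f(γ)(q) = 0` for `γ ∈ Γ₀(N)`,
`q ∈ ℤ²`), then `f = 0` — the injectivity of the *real* Eichler–Shimura map
`S_{n+2}(Γ₀(N)) → Hom(periodLatticeK, ℝ)`, `f ↦ re (· f)`. [cite: Shimura1971, Thm. 8.4] -/
theorem eq_zero_of_forall_re_periodLatticeK_eq_zero (hn : Even n) (f : CuspForm (Gamma0 N) (n + 2))
    (h : ∀ φ ∈ periodLatticeK (N := N) n, (φ f).re = 0) : f = 0 := by
  refine eq_zero_of_re_periodFn_int_coboundary n hn f 0 fun γ q ↦ ?_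
  rw [map_zero]
  simpa using h _ (periodFunctionalK_mem γ q)

/-- **The period lattice spans the dual space over `ℝ`** (even weight `n + 2`, every level `N`):
`ℝ · periodLatticeK n = S_{n+2}(Γ₀(N))^∨` — the "maximal rank" half of Shimura's (3.5.20) for
`Γ₀(N)` that says the real Eichler–Shimura map is injective (a real-linear functional on the dual
vanishing on the lattice is `φ ↦ re φ(f)` for a form `f` with purely imaginary periods).
[cite: Shimura1971, Thm. 8.4 and (3.5.20)] -/
theorem periodLatticeK_span_real_eq_top (hn : Even n) :
    Submodule.span ℝ (periodLatticeK (N := N) n :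
      Set (Module.Dual ℂ (CuspForm (Gamma0 N) (n + 2)))) = ⊤ := by
  haveI : FiniteDimensional ℂ (CuspForm (Gamma0 N) (n + 2)) :=
    finiteDimensional_cuspForm_gamma0 N (n + 2)
  by_contra htop
  obtain ⟨ℓ, hℓ, hker⟩ := Submodule.exists_le_ker_of_lt_top _ (lt_top_iff_ne_top.mpr htop)
  let ψ : Module.Dual ℂ (Module.Dual ℂ (CuspForm (Gamma0 N) (n + 2))) := Module.Dual.extendRCLike ℓ
  have hψ : ∀ φ, (ψ φ).re = ℓ φ := fun φ ↦ Module.Dual.re_extendRCLike_apply (𝕜 := ℂ) ℓ φ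
  obtain ⟨f, hf⟩ := (Module.evalEquiv ℂ (CuspForm (Gamma0 N) (n + 2))).surjective ψ
  have h0 : f = 0 := by
    refine eq_zero_of_forall_re_periodLatticeK_eq_zero n hn f fun φ hφ ↦ ?_
    have h1 : ℓ φ = 0 := hker (Submodule.subset_span hφ)
    rw [← hψ, ← hf] at h1
    simpa using h1
  apply hℓ
  ext φ
  rw [← hψ, ← hf, h0]
  simp

end Main

end Literature.NumberTheory.EllipticCurves.ModularForms
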